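import Literature.Analysis.FluidPDE.LocalLerayWeakTrace
import Literature.Analysis.FluidPDE.LocalEnergyTimeCompactness
import HarnessLib

/-!
# The weakly continuous representative of a distributional Navier–Stokes solution with
# uniformly local energy on the slab `(0, ∞) × ℝ³`, and equicontinuity of the pairings

Analysis/FluidPDE proof file (theorems only: no definitions, no named facts), second of three
files on the inline proof path of the named fact
`Literature.Analysis.FluidPDE.localLeray_limit_isLocalLeraySolution` (**Lim**,
`LocalLerayLimitingProcedure.lean`; Jia–Šverák 2013, proof of Thm. 1: "`u^k(·,t) ⇀ u(·,t)` in
`L²(B₁(x₀))` for every `t`"; Lemarié-Rieusset 2016, p. 571: "`v_∞ ∈ 𝒞([0,1], H^{-3/2}_uloc)` and,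
for every `t`, `v_∞(t,.)` is the weak* limit of `v_{n_k}(t,.)`"; Seregin 2014, (7.3.8), (B.4.10)).
The limit `U` handed over by Rusin–Šverák's Prop. 2.2 is only a distributional (suitable weak)
solution on the open slab with a.e.-in-time uniformly local energy bounds; the conclusion of
**Lim** asks for a representative `U'` (equal to `U` at a.e. time) which is weakly continuous on
`(0, ∞)` and whose pairings at every `t₀ > 0` are the limits of the essential traces of the
approximants. This file proves the time-wise tools, for a distributional solution `(U, P)` on
`(0,∞) × ℝ³` with `∫_{B(x₀,1)} |U(t)|² ≤ A(S)` for a.e. `t ∈ (0,S)`, all `x₀`, all `S`: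

* `exists_weak_trace` — at every `T > 0` a measurable field `U_T ∈ L²_loc` with
  `∫⟪U(t), φ⟫ → ∫⟪U_T, φ⟫` along a.e. `t → T` for all test fields (Kang–Miura–Tsai 2021, remark
  after Def. 3.1; copy of `IsLocalLeraySolution.exists_weak_trace`, `LocalLerayWeakTrace.lean`, for
  the raw hypotheses);
* `continuousOn_limUnder_pairing` — the essential limits `t ↦ lim_{s→t, a.e.} ∫⟪U(s), η⟫` are
  continuous on `(0,∞)` and agree with the pairing a.e. (du Bois-Reymond on every interval,
  `exists_continuousOn_version_Ioo`, which also records the increment `V t − V s = ∫ₛᵗ f_η`);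
* `exists_weaklyContinuous_representative` — **the weakly continuous representative**: `U'` with
  `U'(t) = U(t)` for a.e. `t > 0`, measurable slices with the every-time bound `A(T)` (`t < T`,
  `A` monotone), `∫⟪U(s), η⟫ → ∫⟪U'(t), η⟫` along a.e. `s → t` at every `t > 0`, and
  `t ↦ ∫⟪U'(t), η⟫` continuous on `(0,∞)` (Seregin 2014, (7.3.6), (7.3.8); Temam 1977, Ch. III,
  Lemma 1.4);
* `exists_modulus_slab` — **equicontinuity of the versions of the pairings, uniformly over
  distributional solutions on the slab** with a common a.e. unit-ball bound `C` on `(0,T)` and a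
  common pressure bound `∫₀ᵀ∫_{B(0,R)} |π|^{3/2} ≤ D`: `|V t − V s| ≤ K (t − s)^{1/3}`, `K`
  depending only on `ν, T, C, D, R, η` (Seregin 2014, (B.4.4), (B.4.10); copies of
  `IsLocalEnergySolutionOn.lintegral_enorm_pairingFlux_le`, `strip_lintegral_bounds`,
  `abs_integral_inner_sub_le_core` of `LocalEnergyTimeCompactness.lean` with a.e.-in-time bounds);
* tools: unit-ball bounds of weak limits by duality (`lintegral_unitBall_le_of_tendsto_pairing`),
  Lipschitz dependence of pairings on the test field (`abs_integral_inner_sub_le_of_bound`).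

## Mathlib / tree search

Tree (all proved, reused): `IsDistributionalNSSolutionOn.exists_tendsto_pairing_nhds_inf_ae`,
`setIntegral_deriv_mul_pairing_add_eq_zero_slab`, `integrableOn_pairing_slab`,
`integrable_pairing_strip` (`LocalLerayPairingContinuity`); `exists_ae_eq_const_add_primitive`,
`exists_bounds_of_isTestFunctionOn` (`NSSliceTimePairing`); `nhds_inf_ae_neBot`,
`dense_span_testField_classes`, `isTestFunctionOn_smul_top`, `inner_eq_integral_of_ae_eq`,
`ae_eq_on_ball_of_forall_test_pairing_eq` (`LocalLerayWeakTrace`);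
`exists_forall_tendsto_inner_of_dense_span` (`WeakSolutionWeakContinuity`);
`exists_dense_seq_isTestFunctionOn`, `abs_integral_inner_le_sqrt_mul_of_ball_bound`,
`ae_aestronglyMeasurable_slice_of_uncurry`, `pairingFlux`, `enorm_gaugedFlux_le`,
`linear_add_rpow_third_le` (`LocalEnergyTimeCompactness`); `eLpNorm_two_le_of_forall_isTestFunctionOn`
(`NSSereginMildCompactness`); `Seregin2014Limit.exists_cover_const` (`LocalEnergyLimitBounds`);
`integrable_inner_of_locallyIntegrable_of_hasCompactSupport` (`WeakGradientIBP`). No weakly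
continuous representative for the raw slab class existed (`lean search 'weaklyContinuous'`: only
`exists_strictMono_weaklyContinuous_representative`, for sequences of `IsLocalEnergySolutionOn`).
Mathlib: `Filter.Tendsto.limUnder_eq`, `exists_mem_Ico_zpow`, `measurableSet_toMeasurable`,
`exists_rat_btwn`, `Measure.restrict_congr_set`.

## References

* K. Kang, H. Miura, T.-P. Tsai, IMRN 2021 = arXiv:1812.10509, §3: Def. 3.1 (6) and the remark
  after Def. 3.1, Lemma 3.4. [KangMiuraTsai2020]
* G. Seregin, *Lecture Notes on Regularity Theory for the Navier–Stokes Equations* (2014),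
  doi:10.1142/9314: Ch. 7 (7.3.6), (7.3.8) (PDF pp. 135–136); App. B §B.4 (B.4.4), (B.4.9),
  (B.4.10) (PDF pp. 160–162). [Seregin2014]
* P. G. Lemarié-Rieusset, *The Navier–Stokes Problem in the 21st Century* (2016),
  doi:10.1201/b19556, p. 568 and proof of Thm. 15.5, p. 571. [LemarieRieusset2016]
* R. Temam, *Navier–Stokes Equations* (1977), Ch. III, Lemmas 1.1, 1.4.
* J. C. Robinson, J. L. Rodrigo, W. Sadowski, *The three-dimensional Navier–Stokes equations*
  (2016), Lemma 13.8.
-/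

noncomputable section

open MeasureTheory TopologicalSpace Set Function Filter Metric
open _root_.Topology
open scoped ENNReal NNReal RealInnerProductSpace Laplacian

namespace Literature.Analysis.FluidPDE

namespace LocalLerayLimit

section Trace

variable {ν : ℝ} {U : ℝ → (EuclideanSpace ℝ (Fin 3)) → (EuclideanSpace ℝ (Fin 3))} {P : ℝ → (EuclideanSpace ℝ (Fin 3)) → ℝ} {A : ℝ → ℝ≥0}

/-! ### Good slices near a positive time, from uniformly local bounds -/

/-- **Good times near `T`** for a measurable field on the slab with an a.e.-in-time unit-ball
bound `A(S)` on every `(0, S)`: along a.e. `t` near `T > 0` the slice `U(t)` is measurable with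
`∫_{B(x₀,1)} |U(t)|² ≤ A(T+1)` for all `x₀` and `∫_{B(0,k+1)} |U(t)|² ≤ N_{k+1} A(T+1)` (window
`(0, T+1) ∋ T`; Tonelli for the measurability of a.e. slice; a finite unit-ball cover).
[folklore] -/
theorem eventually_good_slice
    (hUm : AEStronglyMeasurable (uncurry U) (volume.restrict (Ioi (0 : ℝ) ×ˢ (univ : Set (EuclideanSpace ℝ (Fin 3))))))
    (hUA : ∀ S : ℝ, ∀ᵐ t ∂(volume.restrict (Ioo (0 : ℝ) S)), ∀ x₀ : (EuclideanSpace ℝ (Fin 3)),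
      ∫⁻ x in ball x₀ 1, ‖U t x‖ₑ ^ 2 ≤ A S)
    {T : ℝ} (hT : 0 < T) (k : ℕ) :
    ∃ N : ℕ, ∀ᶠ t in 𝓝 T ⊓ ae (volume : Measure ℝ),
      AEStronglyMeasurable (U t) volume ∧
        (∀ x₀ : (EuclideanSpace ℝ (Fin 3)), ∫⁻ x in ball x₀ 1, ‖U t x‖ₑ ^ 2 ≤ A (T + 1)) ∧
        ∫⁻ x in ball (0 : (EuclideanSpace ℝ (Fin 3))) (k + 1), ‖U t x‖ₑ ^ 2 ≤ ((N * A (T + 1) : ℝ≥0) : ℝ≥0∞) := by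
  obtain ⟨N, hN, -⟩ := Seregin2014Limit.exists_cover_const ((k : ℝ) + 1)
  refine ⟨N, ?_⟩
  have hmeas : AEStronglyMeasurable (uncurry U)
      (volume.restrict (Ioo (0 : ℝ) (T + 1) ×ˢ (univ : Set (EuclideanSpace ℝ (Fin 3))))) :=
    hUm.mono_measure (Measure.restrict_mono (Set.prod_mono Ioo_subset_Ioi_self Subset.rfl) le_rfl)
  have h1 := (ae_restrict_iff' (measurableSet_Ioo (a := (0 : ℝ)) (b := T + 1))).1
    (ae_aestronglyMeasurable_slice_of_uncurry hmeas)
  have h2 := (ae_restrict_iff' (measurableSet_Ioo (a := (0 : ℝ)) (b := T + 1))).1 (hUA (T + 1))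
  have hI : ∀ᶠ t in 𝓝 T ⊓ ae (volume : Measure ℝ), t ∈ Ioo 0 (T + 1) :=
    mem_inf_of_left (Ioo_mem_nhds hT (lt_add_one T))
  filter_upwards [hI, mem_inf_of_right (f := 𝓝 T) h1, mem_inf_of_right (f := 𝓝 T) h2]
    with t htI hm hb
  refine ⟨hm htI, hb htI, ?_⟩
  calc ∫⁻ x in ball (0 : (EuclideanSpace ℝ (Fin 3))) (k + 1), ‖U t x‖ₑ ^ 2 ≤ N * A (T + 1) :=
        hN (fun x => ‖U t x‖ₑ ^ 2) (A (T + 1)) (hb htI) 0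
    _ = ((N * A (T + 1) : ℝ≥0) : ℝ≥0∞) := by push_cast; rfl

/-! ### The representing field on a ball, and the weak trace at every positive time -/

/-- **The representing field on a ball** (copy of `IsLocalLeraySolution.exists_weak_trace_ball`
for a distributional solution on the slab with uniformly local energy): for `T > 0` and `k ∈ ℕ`
there is `Y ∈ L²(ℝ³; ℝ³)` with `∫ ⟪U(t), φ⟫ → ∫ ⟪Y, φ⟫` along a.e. `t → T` for every test
field `φ` supported in `B̄(0, k)` (weak limit of the bounded classes `[χ_k U(t)]` from the
convergence of their pairings with the dense classes of test fields). [folklore] -/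
theorem exists_weak_trace_ball
    (hsol : IsDistributionalNSSolutionOn (slab (EuclideanSpace ℝ (Fin 3)) (Ioi 0) isOpen_Ioi) ν 0 U P)
    (hUm : AEStronglyMeasurable (uncurry U) (volume.restrict (Ioi (0 : ℝ) ×ˢ (univ : Set (EuclideanSpace ℝ (Fin 3))))))
    (hUA : ∀ S : ℝ, ∀ᵐ t ∂(volume.restrict (Ioo (0 : ℝ) S)), ∀ x₀ : (EuclideanSpace ℝ (Fin 3)),
      ∫⁻ x in ball x₀ 1, ‖U t x‖ₑ ^ 2 ≤ A S)
    {T : ℝ} (hT : 0 < T) (k : ℕ) :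
    ∃ Y : (EuclideanSpace ℝ (Fin 3)) → (EuclideanSpace ℝ (Fin 3)), StronglyMeasurable Y ∧ MemLp Y 2 volume ∧
      ∀ φ : (EuclideanSpace ℝ (Fin 3)) → (EuclideanSpace ℝ (Fin 3)), FunctionSpaces.IsTestFunctionOn (⊤ : Opens (EuclideanSpace ℝ (Fin 3))) φ →
        tsupport φ ⊆ closedBall (0 : (EuclideanSpace ℝ (Fin 3))) k →
        Tendsto (fun t => ∫ x, ⟪U t x, φ x⟫) (𝓝 T ⊓ ae (volume : Measure ℝ))
          (𝓝 (∫ x, ⟪Y x, φ x⟫)) := by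
  haveI : (𝓝 T ⊓ ae (volume : Measure ℝ)).NeBot := nhds_inf_ae_neBot T
  -- the cut-off `χ`: `1` on `B̄(0,k)`, supported in `B(0, k+1)`, values in `[0,1]`
  obtain ⟨χ, hχ, hχc, hχsupp, hχ1, hχ01⟩ := FunctionSpaces.exists_smooth_cutoff_mem_Icc
    (isCompact_closedBall (0 : (EuclideanSpace ℝ (Fin 3))) k) isOpen_ball (closedBall_subset_ball (lt_add_one (k : ℝ)))
  have hχcont : Continuous χ := hχ.continuous
  -- good times
  obtain ⟨N, hgood'⟩ := eventually_good_slice hUm hUA hT k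
  set C : ℝ≥0 := N * A (T + 1) with hC
  have hgood : ∀ᶠ t in 𝓝 T ⊓ ae (volume : Measure ℝ), AEStronglyMeasurable (U t) volume ∧
      ∫⁻ x in ball (0 : (EuclideanSpace ℝ (Fin 3))) (k + 1), ‖U t x‖ₑ ^ 2 ≤ C := by
    filter_upwards [hgood'] with t ht using ⟨ht.1, ht.2.2⟩
  -- the truncated slices are in `L²` with norm ≤ `M` at good times
  set M : ℝ := ((C : ℝ≥0∞) ^ (1 / 2 : ℝ)).toReal with hM_def
  have hmem : ∀ t, AEStronglyMeasurable (U t) volume →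
      ∫⁻ x in ball (0 : (EuclideanSpace ℝ (Fin 3))) (k + 1), ‖U t x‖ₑ ^ 2 ≤ C →
      MemLp (fun x => χ x • U t x) 2 volume ∧
        eLpNorm (fun x => χ x • U t x) 2 volume ≤ (C : ℝ≥0∞) ^ (1 / 2 : ℝ) := by
    intro t hm hb
    have hmeas : AEStronglyMeasurable (fun x => χ x • U t x) volume :=
      hχcont.aestronglyMeasurable.smul hm
    have hpt : ∀ x, ‖χ x • U t x‖ₑ ^ 2 ≤
        (ball (0 : (EuclideanSpace ℝ (Fin 3))) (k + 1)).indicator (fun x => ‖U t x‖ₑ ^ 2) x := by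
      intro x
      by_cases hx : x ∈ ball (0 : (EuclideanSpace ℝ (Fin 3))) (k + 1)
      · rw [indicator_of_mem hx, enorm_smul]
        have h1 : ‖χ x‖ₑ ≤ 1 := by
          rw [Real.enorm_eq_ofReal (hχ01 x).1]
          exact ENNReal.ofReal_le_one.2 (hχ01 x).2
        calc (‖χ x‖ₑ * ‖U t x‖ₑ) ^ 2 ≤ (1 * ‖U t x‖ₑ) ^ 2 := by gcongr
          _ = ‖U t x‖ₑ ^ 2 := by rw [one_mul]
      · have h0 : χ x = 0 := image_eq_zero_of_notMem_tsupport fun h => hx (hχsupp h)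
        rw [indicator_of_notMem hx, h0, zero_smul, enorm_zero, zero_pow two_ne_zero]
    have hlin : ∫⁻ x, ‖χ x • U t x‖ₑ ^ 2 ≤ C :=
      calc ∫⁻ x, ‖χ x • U t x‖ₑ ^ 2
          ≤ ∫⁻ x, (ball (0 : (EuclideanSpace ℝ (Fin 3))) (k + 1)).indicator (fun x => ‖U t x‖ₑ ^ 2) x := lintegral_mono hpt
        _ = ∫⁻ x in ball (0 : (EuclideanSpace ℝ (Fin 3))) (k + 1), ‖U t x‖ₑ ^ 2 := lintegral_indicator measurableSet_ball _
        _ ≤ C := hb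
    have hnorm : eLpNorm (fun x => χ x • U t x) 2 volume ≤ (C : ℝ≥0∞) ^ (1 / 2 : ℝ) := by
      rw [eLpNorm_eq_lintegral_rpow_enorm_toReal two_ne_zero ENNReal.ofNat_ne_top,
        ENNReal.toReal_ofNat, one_div]
      have e : ∫⁻ x, ‖χ x • U t x‖ₑ ^ (2 : ℝ) = ∫⁻ x, ‖χ x • U t x‖ₑ ^ 2 :=
        lintegral_congr fun x => by rw [← ENNReal.rpow_natCast]; norm_num
      rw [e]
      exact ENNReal.rpow_le_rpow hlin (by norm_num)
    exact ⟨⟨hmeas, lt_of_le_of_lt hnorm (ENNReal.rpow_lt_top_of_nonneg (by norm_num)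
      ENNReal.coe_ne_top)⟩, hnorm⟩
  -- the classes
  classical
  set X : ℝ → Lp (EuclideanSpace ℝ (Fin 3)) 2 (volume : Measure (EuclideanSpace ℝ (Fin 3))) :=
    fun t => if h : MemLp (fun x => χ x • U t x) 2 volume then h.toLp _ else 0 with hX_def
  have hXgood : ∀ t, AEStronglyMeasurable (U t) volume →
      ∫⁻ x in ball (0 : (EuclideanSpace ℝ (Fin 3))) (k + 1), ‖U t x‖ₑ ^ 2 ≤ C →
      ∃ h : MemLp (fun x => χ x • U t x) 2 volume, X t = h.toLp _ ∧ ‖X t‖ ≤ M := by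
    intro t hm hb
    obtain ⟨h, hnorm⟩ := hmem t hm hb
    refine ⟨h, by rw [hX_def]; exact dif_pos h, ?_⟩
    rw [hX_def]
    simp only [dif_pos h, Lp.norm_toLp, hM_def]
    exact ENNReal.toReal_mono (ENNReal.rpow_ne_top_of_nonneg (by norm_num) ENNReal.coe_ne_top) hnorm
  have hbound : ∀ᶠ t in 𝓝 T ⊓ ae (volume : Measure ℝ), ‖X t‖ ≤ M := by
    filter_upwards [hgood] with t ht
    exact (hXgood t ht.1 ht.2).choose_spec.2
  -- pairings of the classes with classes of test fields are pairings of `U t` with `χ φ`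
  have hpair : ∀ t, AEStronglyMeasurable (U t) volume →
      ∫⁻ x in ball (0 : (EuclideanSpace ℝ (Fin 3))) (k + 1), ‖U t x‖ₑ ^ 2 ≤ C →
      ∀ (d : Lp (EuclideanSpace ℝ (Fin 3)) 2 (volume : Measure (EuclideanSpace ℝ (Fin 3)))) (φ : (EuclideanSpace ℝ (Fin 3)) → (EuclideanSpace ℝ (Fin 3))), (d : (EuclideanSpace ℝ (Fin 3)) → (EuclideanSpace ℝ (Fin 3))) =ᵐ[volume] φ →
        ⟪X t, d⟫ = ∫ x, ⟪U t x, χ x • φ x⟫ := by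
    intro t hm hb d φ hd
    obtain ⟨h, hX, -⟩ := hXgood t hm hb
    rw [hX, MeasureTheory.L2.inner_def]
    refine integral_congr_ae ?_
    filter_upwards [h.coeFn_toLp, hd] with x hx hdx
    rw [hx, hdx, real_inner_smul_left, real_inner_smul_right]
  -- convergence of the pairings against the dense set
  set D : Set (Lp (EuclideanSpace ℝ (Fin 3)) 2 (volume : Measure (EuclideanSpace ℝ (Fin 3)))) :=
    {d | ∃ φ : (EuclideanSpace ℝ (Fin 3)) → (EuclideanSpace ℝ (Fin 3)), FunctionSpaces.IsTestFunctionOn (⊤ : Opens (EuclideanSpace ℝ (Fin 3))) φ ∧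
      (d : (EuclideanSpace ℝ (Fin 3)) → (EuclideanSpace ℝ (Fin 3))) =ᵐ[volume] φ} with hD_def
  have hconv : ∀ d ∈ D, ∃ L : ℝ, Tendsto (fun t => ⟪X t, d⟫) (𝓝 T ⊓ ae (volume : Measure ℝ))
      (𝓝 L) := by
    rintro d ⟨φ, hφ, hdφ⟩
    obtain ⟨L, hL⟩ := hsol.exists_tendsto_pairing_nhds_inf_ae hT (isTestFunctionOn_smul_top hχ hφ)
    refine ⟨L, hL.congr' ?_⟩
    filter_upwards [hgood] with t ht
    exact (hpair t ht.1 ht.2 d φ hdφ).symm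
  obtain ⟨Y, -, hY⟩ := exists_forall_tendsto_inner_of_dense_span hbound dense_span_testField_classes
    hconv
  -- a strongly measurable representative
  refine ⟨(Lp.memLp Y).aestronglyMeasurable.mk _, (Lp.memLp Y).aestronglyMeasurable.stronglyMeasurable_mk,
    (Lp.memLp Y).ae_eq (Lp.memLp Y).aestronglyMeasurable.ae_eq_mk, fun φ hφ hφk => ?_⟩
  have hφ2 : MemLp φ 2 (volume : Measure (EuclideanSpace ℝ (Fin 3))) :=
    hφ.contDiff.continuous.memLp_of_hasCompactSupport hφ.hasCompactSupport
  have hd : ((hφ2.toLp φ : Lp (EuclideanSpace ℝ (Fin 3)) 2 volume) : (EuclideanSpace ℝ (Fin 3)) → (EuclideanSpace ℝ (Fin 3))) =ᵐ[volume] φ := hφ2.coeFn_toLp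
  have h1 := hY (hφ2.toLp φ)
  -- `χ φ = φ`
  have hχφ : ∀ x, χ x • φ x = φ x := by
    intro x
    by_cases hx : x ∈ tsupport φ
    · rw [hχ1 x (hφk hx), one_smul]
    · rw [image_eq_zero_of_notMem_tsupport hx, smul_zero]
  have hlim : ⟪Y, hφ2.toLp φ⟫ = ∫ x, ⟪(Lp.memLp Y).aestronglyMeasurable.mk _ x, φ x⟫ := by
    rw [inner_eq_integral_of_ae_eq Y _ hd]
    exact integral_congr_ae (((Lp.memLp Y).aestronglyMeasurable.ae_eq_mk).mono
      fun x hx => by simp only [hx])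
  rw [← hlim]
  refine h1.congr' ?_
  filter_upwards [hgood] with t ht
  rw [hpair t ht.1 ht.2 _ φ hd]
  exact integral_congr_ae (Eventually.of_forall fun x => by simp only [hχφ x])

/-- **Weak traces in `L²_loc` at every positive time** (copy of
`IsLocalLeraySolution.exists_weak_trace` for a distributional solution on the slab with
uniformly local energy; Kang–Miura–Tsai 2021, remark after Def. 3.1; Temam 1977, Ch. III,
Lemma 1.4): for `T > 0` there is a measurable `U_T` with `∫ ⟪U(t), φ⟫ → ∫ ⟪U_T, φ⟫` along a.e.
`t → T` for every test field `φ` (patching the representing fields of the balls `B̄(0,k)` along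
`k = ⌊|x|⌋ + 1`). [cite: KangMiuraTsai2020, Def. 3.1 (6) with the remark after Def. 3.1] -/
theorem exists_weak_trace
    (hsol : IsDistributionalNSSolutionOn (slab (EuclideanSpace ℝ (Fin 3)) (Ioi 0) isOpen_Ioi) ν 0 U P)
    (hUm : AEStronglyMeasurable (uncurry U) (volume.restrict (Ioi (0 : ℝ) ×ˢ (univ : Set (EuclideanSpace ℝ (Fin 3))))))
    (hUA : ∀ S : ℝ, ∀ᵐ t ∂(volume.restrict (Ioo (0 : ℝ) S)), ∀ x₀ : (EuclideanSpace ℝ (Fin 3)),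
      ∫⁻ x in ball x₀ 1, ‖U t x‖ₑ ^ 2 ≤ A S)
    {T : ℝ} (hT : 0 < T) :
    ∃ UT : (EuclideanSpace ℝ (Fin 3)) → (EuclideanSpace ℝ (Fin 3)), StronglyMeasurable UT ∧ (∀ k : ℕ, MemLp UT 2 (volume.restrict (ball (0 : (EuclideanSpace ℝ (Fin 3))) k))) ∧
      ∀ φ : (EuclideanSpace ℝ (Fin 3)) → (EuclideanSpace ℝ (Fin 3)), FunctionSpaces.IsTestFunctionOn (⊤ : Opens (EuclideanSpace ℝ (Fin 3))) φ →
        Tendsto (fun t => ∫ x, ⟪U t x, φ x⟫) (𝓝 T ⊓ ae (volume : Measure ℝ))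
          (𝓝 (∫ x, ⟪UT x, φ x⟫)) := by
  haveI : (𝓝 T ⊓ ae (volume : Measure ℝ)).NeBot := nhds_inf_ae_neBot T
  choose Y hYm hY2 hYlim using fun k : ℕ => exists_weak_trace_ball hsol hUm hUA hT k
  -- consistency on the smaller ball
  have hcons : ∀ j k : ℕ, j ≤ k → ∀ᵐ x ∂(volume : Measure (EuclideanSpace ℝ (Fin 3))), x ∈ ball (0 : (EuclideanSpace ℝ (Fin 3))) j → Y j x = Y k x := by
    intro j k hjk
    refine ae_eq_on_ball_of_forall_test_pairing_eq (hY2 j) (hY2 k) fun φ hφ hφj => ?_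
    have hj : tsupport φ ⊆ closedBall (0 : (EuclideanSpace ℝ (Fin 3))) j := hφj.trans ball_subset_closedBall
    have hk : tsupport φ ⊆ closedBall (0 : (EuclideanSpace ℝ (Fin 3))) k :=
      hj.trans (closedBall_subset_closedBall (by exact_mod_cast hjk))
    exact tendsto_nhds_unique (hYlim j φ hφ hj) (hYlim k φ hφ hk)
  have hall : ∀ᵐ x ∂(volume : Measure (EuclideanSpace ℝ (Fin 3))), ∀ j k : ℕ, j ≤ k → x ∈ ball (0 : (EuclideanSpace ℝ (Fin 3))) j → Y j x = Y k x := by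
    refine ae_all_iff.2 fun j => ae_all_iff.2 fun k => ?_
    by_cases hjk : j ≤ k
    · filter_upwards [hcons j k hjk] with x hx using fun _ => hx
    · exact Eventually.of_forall fun x h => absurd h hjk
  -- the patched field
  set n : (EuclideanSpace ℝ (Fin 3)) → ℕ := fun x => ⌊‖x‖⌋₊ + 1 with hn
  have hn_meas : Measurable n := (Nat.measurable_floor.comp measurable_norm).add_const 1
  have hxn : ∀ x : (EuclideanSpace ℝ (Fin 3)), x ∈ ball (0 : (EuclideanSpace ℝ (Fin 3))) (n x) := by
    intro x
    rw [mem_ball_zero_iff, hn]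
    push_cast
    exact Nat.lt_floor_add_one ‖x‖
  have hnle : ∀ (k : ℕ) (x : (EuclideanSpace ℝ (Fin 3))), x ∈ ball (0 : (EuclideanSpace ℝ (Fin 3))) k → n x ≤ k := by
    intro k x hx
    rw [mem_ball_zero_iff] at hx
    have : ⌊‖x‖⌋₊ < k := (Nat.floor_lt (norm_nonneg _)).2 hx
    show ⌊‖x‖⌋₊ + 1 ≤ k
    omega
  set vT : (EuclideanSpace ℝ (Fin 3)) → (EuclideanSpace ℝ (Fin 3)) := fun x => Y (n x) x with hvT
  have hvT_meas : Measurable vT := by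
    have hF : Measurable (fun q : (EuclideanSpace ℝ (Fin 3)) × ℕ => Y q.2 q.1) :=
      measurable_from_prod_countable_left fun k => (hYm k).measurable
    exact hF.comp (measurable_id.prodMk hn_meas)
  -- `vT = Y k` a.e. on `B(0, k)`
  have hvT_ball : ∀ k : ℕ, ∀ᵐ x ∂(volume : Measure (EuclideanSpace ℝ (Fin 3))), x ∈ ball (0 : (EuclideanSpace ℝ (Fin 3))) k → vT x = Y k x := by
    intro k
    filter_upwards [hall] with x hx hxk
    exact hx (n x) k (hnle k x hxk) (hxn x)
  refine ⟨vT, hvT_meas.stronglyMeasurable, fun k => ?_, ?_⟩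
  · -- `vT ∈ L²(B(0,k))`
    have h1 : MemLp (Y k) 2 (volume.restrict (ball (0 : (EuclideanSpace ℝ (Fin 3))) k)) := (hY2 k).restrict _
    refine h1.ae_eq ?_
    rw [Filter.EventuallyEq, ae_restrict_iff' measurableSet_ball]
    filter_upwards [hvT_ball k] with x hx hxb
    rw [hx hxb]
  · -- the pairings
    intro φ hφ
    obtain ⟨r, hr⟩ := (hφ.hasCompactSupport.isCompact.isBounded).subset_ball (0 : (EuclideanSpace ℝ (Fin 3)))
    set k : ℕ := ⌈r⌉₊ with hk
    have hφk : tsupport φ ⊆ ball (0 : (EuclideanSpace ℝ (Fin 3))) k :=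
      hr.trans (ball_subset_ball (by rw [hk]; exact Nat.le_ceil r))
    have h1 := hYlim k φ hφ (hφk.trans ball_subset_closedBall)
    have h2 : ∫ x, ⟪Y k x, φ x⟫ = ∫ x, ⟪vT x, φ x⟫ := by
      refine integral_congr_ae ?_
      filter_upwards [hvT_ball k] with x hx
      by_cases hxb : x ∈ ball (0 : (EuclideanSpace ℝ (Fin 3))) k
      · rw [hx hxb]
      · have h0 : φ x = 0 := image_eq_zero_of_notMem_tsupport fun h => hxb (hφk h)
        simp only [h0, inner_zero_right]
    rw [← h2]
    exact h1


/-! ### The continuous version of the pairings (du Bois-Reymond on every interval) -/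

/-- **On an interval `]a, b[`, `0 < a`, the pairing `t ↦ ∫⟪U(t), η⟫` agrees a.e. with a function
continuous on `[a, b]`, which is its essential limit at every interior time** (the momentum
equation tested with `χ(t) η(x)` and du Bois-Reymond: `g_η = c + ∫ₐᵗ f_η` a.e.;
Robinson–Rodrigo–Sadowski 2016, Lemma 13.8; Temam 1977, Ch. III, Lemma 1.1). [folklore] -/
theorem exists_continuousOn_version_Ioo
    (hsol : IsDistributionalNSSolutionOn (slab (EuclideanSpace ℝ (Fin 3)) (Ioi 0) isOpen_Ioi) ν 0 U P)
    {a b : ℝ} (ha : 0 < a) {η : (EuclideanSpace ℝ (Fin 3)) → (EuclideanSpace ℝ (Fin 3))} (hη : FunctionSpaces.IsTestFunctionOn (⊤ : Opens (EuclideanSpace ℝ (Fin 3))) η) :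
    ∃ V : ℝ → ℝ, ContinuousOn V (Icc a b) ∧
      (∀ t ∈ Ioo a b, Tendsto (fun s => ∫ x, ⟪U s x, η x⟫) (𝓝 t ⊓ ae (volume : Measure ℝ)) (𝓝 (V t))) ∧
      (∀ᵐ t ∂(volume.restrict (Ioo a b)), (∫ x, ⟪U t x, η x⟫) = V t) ∧
      ∀ s ∈ Ioo a b, ∀ t ∈ Ioo a b, s ≤ t → V t - V s = ∫ τ in Ioc s t, pairingFlux ν U P η τ := by
  obtain ⟨hgI, hfI⟩ := hsol.integrableOn_pairing_slab ha (b := b) hη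
  obtain ⟨c, hc⟩ := exists_ae_eq_const_add_primitive hgI hfI fun χ hχ hχc hχI =>
    hsol.setIntegral_deriv_mul_pairing_add_eq_zero_slab ha hχ hχc hχI hη
  set g : ℝ → ℝ := fun t => ∫ x, ⟪U t x, η x⟫ with hg
  set f : ℝ → ℝ := fun t => ∫ x, (⟪U t x, fderiv ℝ η x (U t x)⟫ + ν * ⟪U t x, Δ η x⟫ +
    P t x * VectorCalculus.divergence η x) with hf
  set V : ℝ → ℝ := fun t => c + ∫ s in Ioc a t, f s with hV
  have hfI' : IntegrableOn f (Icc a b) volume :=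
    (integrableOn_Icc_iff_integrableOn_Ioo (by simp) (by simp)).2 hfI
  have hVc : ContinuousOn V (Icc a b) :=
    continuousOn_const.add (intervalIntegral.continuousOn_primitive hfI')
  refine ⟨V, hVc, fun t ht => ?_, hc, fun s hs t ht hst => ?_⟩
  swap
  · -- the increment
    have hunion : Ioc a s ∪ Ioc s t = Ioc a t := Ioc_union_Ioc_eq_Ioc hs.1.le hst
    have hdisj : Disjoint (Ioc a s) (Ioc s t) :=
      Set.disjoint_left.2 fun x hx hx' => (not_lt.2 hx.2) hx'.1
    have hIs : IntegrableOn f (Ioc a s) volume := hfI'.mono_set (Ioc_subset_Icc_self.trans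
      (Icc_subset_Icc le_rfl hs.2.le))
    have hIt : IntegrableOn f (Ioc s t) volume := hfI'.mono_set fun x hx =>
      ⟨(hs.1.trans hx.1).le, hx.2.trans ht.2.le⟩
    have e : ∫ x in Ioc a t, f x = (∫ x in Ioc a s, f x) + ∫ x in Ioc s t, f x := by
      rw [← hunion, setIntegral_union hdisj measurableSet_Ioc hIs hIt]
    show (c + ∫ x in Ioc a t, f x) - (c + ∫ x in Ioc a s, f x) = ∫ τ in Ioc s t, pairingFlux ν U P η τ
    rw [e]
    simp only [pairingFlux_def, hf]
    ring
  have hVt : Tendsto V (𝓝 t) (𝓝 (V t)) := (hVc.continuousAt (Icc_mem_nhds ht.1 ht.2)).tendsto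
  refine (hVt.mono_left inf_le_left).congr' ?_
  have hA : ∀ᶠ s in 𝓝 t ⊓ ae (volume : Measure ℝ), s ∈ Ioo a b :=
    mem_inf_of_left (Ioo_mem_nhds ht.1 ht.2)
  have hB : ∀ᶠ s in 𝓝 t ⊓ ae (volume : Measure ℝ), s ∈ Ioo a b → g s = V s :=
    mem_inf_of_right ((ae_restrict_iff' measurableSet_Ioo).1 hc)
  filter_upwards [hA, hB] with s hs h using (h hs).symm

/-- **The essential limits of the pairings define a function continuous on `(0, ∞)` which agrees
with the pairing a.e.**: with `V(t) = lim_{s → t, a.e. s} ∫⟪U(s), η⟫` (the limit along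
`𝓝 t ⊓ ae volume`, which exists at every `t > 0`), `V` is continuous on `(0, ∞)`,
`∫⟪U(t), η⟫ → V(t)` along a.e. `s → t` for every `t > 0`, and `∫⟪U(t), η⟫ = V(t)` for a.e.
`t > 0` (Kang–Miura–Tsai 2021, remark after Def. 3.1: weak continuity after redefinition on a
null set of times). [cite: KangMiuraTsai2020, remark after Def. 3.1] -/
theorem continuousOn_limUnder_pairing
    (hsol : IsDistributionalNSSolutionOn (slab (EuclideanSpace ℝ (Fin 3)) (Ioi 0) isOpen_Ioi) ν 0 U P)
    {η : (EuclideanSpace ℝ (Fin 3)) → (EuclideanSpace ℝ (Fin 3))} (hη : FunctionSpaces.IsTestFunctionOn (⊤ : Opens (EuclideanSpace ℝ (Fin 3))) η) :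
    ContinuousOn (fun t => limUnder (𝓝 t ⊓ ae (volume : Measure ℝ)) (fun s => ∫ x, ⟪U s x, η x⟫))
        (Ioi 0) ∧
      (∀ t : ℝ, 0 < t → Tendsto (fun s => ∫ x, ⟪U s x, η x⟫) (𝓝 t ⊓ ae (volume : Measure ℝ))
        (𝓝 (limUnder (𝓝 t ⊓ ae (volume : Measure ℝ)) (fun s => ∫ x, ⟪U s x, η x⟫)))) ∧
      ∀ᵐ t ∂(volume.restrict (Ioi (0 : ℝ))),
        (∫ x, ⟪U t x, η x⟫) = limUnder (𝓝 t ⊓ ae (volume : Measure ℝ)) (fun s => ∫ x, ⟪U s x, η x⟫) := by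
  set g : ℝ → ℝ := fun t => ∫ x, ⟪U t x, η x⟫ with hg
  set W : ℝ → ℝ := fun t => limUnder (𝓝 t ⊓ ae (volume : Measure ℝ)) g with hW
  haveI : ∀ t : ℝ, (𝓝 t ⊓ ae (volume : Measure ℝ)).NeBot := fun t => nhds_inf_ae_neBot t
  -- on `]t₀/2, 2t₀[`: the continuous version `V` and `W = V` there
  have hloc : ∀ t₀ : ℝ, 0 < t₀ → ∃ V : ℝ → ℝ, ContinuousOn V (Icc (t₀ / 2) (2 * t₀)) ∧
      (∀ t ∈ Ioo (t₀ / 2) (2 * t₀), Tendsto g (𝓝 t ⊓ ae (volume : Measure ℝ)) (𝓝 (V t)) ∧ W t = V t) ∧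
      ∀ᵐ t ∂(volume.restrict (Ioo (t₀ / 2) (2 * t₀))), g t = V t := by
    intro t₀ ht₀
    obtain ⟨V, hVc, hVlim, hVae, -⟩ := exists_continuousOn_version_Ioo hsol (half_pos ht₀) (b := 2 * t₀) hη
    refine ⟨V, hVc, fun t ht => ⟨hVlim t ht, (hVlim t ht).limUnder_eq⟩, hVae⟩
  refine ⟨fun t₀ ht₀ => ?_, fun t ht => ?_, ?_⟩
  · -- continuity at `t₀ > 0`
    have ht₀' : 0 < t₀ := ht₀
    obtain ⟨V, hVc, hVW, -⟩ := hloc t₀ ht₀'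
    have hmem : t₀ ∈ Ioo (t₀ / 2) (2 * t₀) := ⟨by linarith, by linarith⟩
    have hnhds : Ioo (t₀ / 2) (2 * t₀) ∈ 𝓝 t₀ := Ioo_mem_nhds hmem.1 hmem.2
    have hVt : ContinuousAt V t₀ := hVc.continuousAt (Icc_mem_nhds hmem.1 hmem.2)
    have hWV : W =ᶠ[𝓝 t₀] V := by
      filter_upwards [hnhds] with t ht using (hVW t ht).2
    exact (hVt.congr_of_eventuallyEq hWV).continuousWithinAt
  · -- the limit at `t > 0`
    obtain ⟨V, -, hVW, -⟩ := hloc t ht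
    have hmem : t ∈ Ioo (t / 2) (2 * t) := ⟨by linarith, by linarith⟩
    have h1 := (hVW t hmem).1
    rw [← (hVW t hmem).2] at h1
    exact h1
  · -- a.e. agreement on `(0, ∞) = ⋃ₙ ](n+1)⁻¹·½·…` : use the intervals `]2ⁿ⁻¹…[`? simpler: `]q/2, 2q[`, `q = 2^k`
    -- cover `(0, ∞)` by the intervals `I n = ](1/2) c_n, 2 c_n[` with `c_n = 2^n` and `c_n = 2^{-n}`
    have hcover : ∀ t : ℝ, 0 < t → ∃ n : ℤ, t ∈ Ioo ((2 : ℝ) ^ n / 2) (2 * (2 : ℝ) ^ n) := by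
      intro t ht
      obtain ⟨n, hn, hn'⟩ := exists_mem_Ico_zpow ht one_lt_two
      refine ⟨n, ?_, ?_⟩
      · have : (0 : ℝ) < 2 ^ n := zpow_pos two_pos n
        linarith
      · rw [zpow_add_one₀ two_ne_zero] at hn'
        linarith
    have hn : ∀ n : ℤ, ∀ᵐ t ∂(volume : Measure ℝ), t ∈ Ioo ((2 : ℝ) ^ n / 2) (2 * (2 : ℝ) ^ n) → g t = W t := by
      intro n
      have hpos : (0 : ℝ) < 2 ^ n := zpow_pos two_pos n
      obtain ⟨V, -, hVW, hVae⟩ := hloc ((2 : ℝ) ^ n) hpos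
      have h1 := (ae_restrict_iff' measurableSet_Ioo).1 hVae
      filter_upwards [h1] with t ht htI
      rw [ht htI, (hVW t htI).2]
    have hall : ∀ᵐ t ∂(volume : Measure ℝ), ∀ n : ℤ, t ∈ Ioo ((2 : ℝ) ^ n / 2) (2 * (2 : ℝ) ^ n) → g t = W t :=
      ae_all_iff.2 hn
    rw [ae_restrict_iff' measurableSet_Ioi]
    filter_upwards [hall] with t ht ht0
    obtain ⟨n, hn⟩ := hcover t ht0
    exact ht n hn


/-! ### Slices with unit-ball bounds: integrability of pairings, Lipschitz dependence on the field -/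

/-- A measurable slice with unit-ball energy bounds is in `L²` of every unit ball. [folklore] -/
theorem memLp_two_unitBall_of_bound {w : (EuclideanSpace ℝ (Fin 3)) → (EuclideanSpace ℝ (Fin 3))} (hwm : AEStronglyMeasurable w volume) {C : ℝ≥0}
    (hC : ∀ x₀ : (EuclideanSpace ℝ (Fin 3)), ∫⁻ x in ball x₀ 1, ‖w x‖ₑ ^ 2 ≤ C) (x₀ : (EuclideanSpace ℝ (Fin 3))) :
    MemLp w 2 (volume.restrict (ball x₀ 1)) := by
  refine ⟨hwm.restrict, ?_⟩
  rw [eLpNorm_two_eq_lintegral_sq_rpow_half]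
  exact ENNReal.rpow_lt_top_of_nonneg (by norm_num) ((hC x₀).trans_lt ENNReal.coe_lt_top).ne

/-- A measurable slice with unit-ball energy bounds is locally integrable. [folklore] -/
theorem locallyIntegrable_of_bound {w : (EuclideanSpace ℝ (Fin 3)) → (EuclideanSpace ℝ (Fin 3))} (hwm : AEStronglyMeasurable w volume) {C : ℝ≥0}
    (hC : ∀ x₀ : (EuclideanSpace ℝ (Fin 3)), ∫⁻ x in ball x₀ 1, ‖w x‖ₑ ^ 2 ≤ C) : LocallyIntegrable w volume := by
  refine fun x₀ => ⟨ball x₀ 1, ball_mem_nhds x₀ one_pos, ?_⟩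
  have h2 := memLp_two_unitBall_of_bound hwm hC x₀
  haveI : IsFiniteMeasure (volume.restrict (ball x₀ (1 : ℝ))) :=
    ⟨by rw [Measure.restrict_apply_univ]; exact measure_ball_lt_top⟩
  exact (h2.mono_exponent (p := 1) (by norm_num)).integrable le_rfl

/-- The pairing of such a slice with a test field is an absolutely convergent integral. [folklore] -/
theorem integrable_inner_of_bound {w : (EuclideanSpace ℝ (Fin 3)) → (EuclideanSpace ℝ (Fin 3))} (hwm : AEStronglyMeasurable w volume) {C : ℝ≥0}
    (hC : ∀ x₀ : (EuclideanSpace ℝ (Fin 3)), ∫⁻ x in ball x₀ 1, ‖w x‖ₑ ^ 2 ≤ C) {φ : (EuclideanSpace ℝ (Fin 3)) → (EuclideanSpace ℝ (Fin 3))}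
    (hφ : FunctionSpaces.IsTestFunctionOn (⊤ : Opens (EuclideanSpace ℝ (Fin 3))) φ) :
    Integrable (fun x => ⟪w x, φ x⟫) volume :=
  integrable_inner_of_locallyIntegrable_of_hasCompactSupport (locallyIntegrable_of_bound hwm hC)
    hφ.contDiff.continuous hφ.hasCompactSupport

/-- **Pairings of a slice with unit-ball bounds are Lipschitz in the test field, in `L²` of a
ball containing the supports**: `|∫⟪w, η⟫ − ∫⟪w, ψ⟫| ≤ (|F| C)^{1/2} ‖η − ψ‖_{L²(B(0,r))}` for test
fields `η, ψ` supported in `B(0, r) ⊆ ⋃_{c ∈ F} B(c, 1)`. [folklore] -/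
theorem abs_integral_inner_sub_le_of_bound {w : (EuclideanSpace ℝ (Fin 3)) → (EuclideanSpace ℝ (Fin 3))} (hwm : AEStronglyMeasurable w volume)
    {C : ℝ≥0} (hC : ∀ x₀ : (EuclideanSpace ℝ (Fin 3)), ∫⁻ x in ball x₀ 1, ‖w x‖ₑ ^ 2 ≤ C)
    {r : ℝ} {F : Finset (EuclideanSpace ℝ (Fin 3))} (hF : ball (0 : (EuclideanSpace ℝ (Fin 3))) r ⊆ ⋃ c ∈ F, ball c 1)
    {η ψ : (EuclideanSpace ℝ (Fin 3)) → (EuclideanSpace ℝ (Fin 3))} (hη : FunctionSpaces.IsTestFunctionOn (⊤ : Opens (EuclideanSpace ℝ (Fin 3))) η)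
    (hψ : FunctionSpaces.IsTestFunctionOn (⊤ : Opens (EuclideanSpace ℝ (Fin 3))) ψ)
    (hηr : tsupport η ⊆ ball (0 : (EuclideanSpace ℝ (Fin 3))) r) (hψr : tsupport ψ ⊆ ball (0 : (EuclideanSpace ℝ (Fin 3))) r) :
    |(∫ x, ⟪w x, η x⟫) - ∫ x, ⟪w x, ψ x⟫| ≤
      Real.sqrt (F.card * C) * (eLpNorm (η - ψ) 2 (volume.restrict (ball (0 : (EuclideanSpace ℝ (Fin 3))) r))).toReal := by
  have hη2 : MemLp η 2 volume := hη.contDiff.continuous.memLp_of_hasCompactSupport hη.hasCompactSupport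
  have hψ2 : MemLp ψ 2 volume := hψ.contDiff.continuous.memLp_of_hasCompactSupport hψ.hasCompactSupport
  have hη0 : ∀ x, x ∉ ball (0 : (EuclideanSpace ℝ (Fin 3))) r → η x = 0 := fun x hx =>
    image_eq_zero_of_notMem_tsupport fun h' => hx (hηr h')
  have hψ0 : ∀ x, x ∉ ball (0 : (EuclideanSpace ℝ (Fin 3))) r → ψ x = 0 := fun x hx =>
    image_eq_zero_of_notMem_tsupport fun h' => hx (hψr h')
  have e : (∫ x, ⟪w x, η x⟫) - ∫ x, ⟪w x, ψ x⟫ = ∫ x, ⟪w x, (η - ψ) x⟫ := by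
    rw [← integral_sub (integrable_inner_of_bound hwm hC hη) (integrable_inner_of_bound hwm hC hψ)]
    refine integral_congr_ae (Eventually.of_forall fun x => ?_)
    simp only [Pi.sub_apply, inner_sub_right]
  rw [e]
  exact abs_integral_inner_le_sqrt_mul_of_ball_bound hwm hC hF ((hη2.restrict _).sub (hψ2.restrict _))
    (fun x hx => by simp only [Pi.sub_apply, hη0 x hx, hψ0 x hx, sub_zero])

/-! ### Every-time unit-ball bounds of weak limits by duality -/

/-- **A weak limit of slices with unit-ball bound `C` along good times has the same unit-ball
bound** (weak lower semicontinuity of the `L²(B(x₀,1))` norm by duality with test fields supported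
in the ball, `eLpNorm_two_le_of_forall_isTestFunctionOn`; Seregin 2014, (B.4.9)).
[cite: Seregin2014, App. B §B.4 (B.4.9)] -/
theorem lintegral_unitBall_le_of_tendsto_pairing {w : (EuclideanSpace ℝ (Fin 3)) → (EuclideanSpace ℝ (Fin 3))} (x₀ : (EuclideanSpace ℝ (Fin 3)))
    (hw2 : MemLp w 2 (volume.restrict (ball x₀ 1)))
    {l : Filter ℝ} [l.NeBot] {U : ℝ → (EuclideanSpace ℝ (Fin 3)) → (EuclideanSpace ℝ (Fin 3))} {C : ℝ≥0}
    (hgood : ∀ᶠ s in l, AEStronglyMeasurable (U s) volume ∧ ∫⁻ x in ball x₀ 1, ‖U s x‖ₑ ^ 2 ≤ C)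
    (hlim : ∀ φ : (EuclideanSpace ℝ (Fin 3)) → (EuclideanSpace ℝ (Fin 3)), FunctionSpaces.IsTestFunctionOn (⊤ : Opens (EuclideanSpace ℝ (Fin 3))) φ →
      Tendsto (fun s => ∫ x, ⟪U s x, φ x⟫) l (𝓝 (∫ x, ⟪w x, φ x⟫))) :
    ∫⁻ x in ball x₀ 1, ‖w x‖ₑ ^ 2 ≤ C := by
  set S : Opens (EuclideanSpace ℝ (Fin 3)) := ⟨ball x₀ 1, isOpen_ball⟩ with hS
  set μS : Measure (EuclideanSpace ℝ (Fin 3)) := volume.restrict (ball x₀ 1) with hμS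
  have hSc : ((S : Opens (EuclideanSpace ℝ (Fin 3))) : Set (EuclideanSpace ℝ (Fin 3))) = ball x₀ 1 := rfl
  set B : ℝ := Real.sqrt C with hB
  have hB0 : 0 ≤ B := Real.sqrt_nonneg _
  -- duality
  have hdual : ∀ g : (EuclideanSpace ℝ (Fin 3)) → (EuclideanSpace ℝ (Fin 3)), FunctionSpaces.IsTestFunctionOn S g →
      |∫ x, ⟪w x, g x⟫| ≤ B * (eLpNorm g 2 μS).toReal := by
    intro g hg
    have hgtop : FunctionSpaces.IsTestFunctionOn (⊤ : Opens (EuclideanSpace ℝ (Fin 3))) g := hg.mono le_top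
    have hg2 : MemLp g 2 volume := hg.contDiff.continuous.memLp_of_hasCompactSupport hg.hasCompactSupport
    have hg0 : ∀ x, x ∉ ball x₀ 1 → g x = 0 := fun x hx =>
      image_eq_zero_of_notMem_tsupport fun h' => hx (hg.tsupport_subset h')
    have hlim' := ((continuous_abs.tendsto _).comp (hlim g hgtop))
    refine le_of_tendsto hlim' ?_
    filter_upwards [hgood] with s hs
    have hs2 : MemLp (U s) 2 μS := by
      refine ⟨hs.1.restrict, ?_⟩
      rw [eLpNorm_two_eq_lintegral_sq_rpow_half]
      exact ENNReal.rpow_lt_top_of_nonneg (by norm_num) (hs.2.trans_lt ENNReal.coe_lt_top).ne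
    have hnorm : (eLpNorm (U s) 2 μS).toReal ≤ B := by
      have h1 : eLpNorm (U s) 2 μS ≤ (C : ℝ≥0∞) ^ (1 / 2 : ℝ) := by
        rw [eLpNorm_two_eq_lintegral_sq_rpow_half]
        exact ENNReal.rpow_le_rpow hs.2 (by norm_num)
      have h2 := ENNReal.toReal_mono (ENNReal.rpow_ne_top_of_nonneg (by norm_num) ENNReal.coe_ne_top) h1
      rw [← ENNReal.toReal_rpow, ENNReal.coe_toReal, ← Real.sqrt_eq_rpow] at h2
      exact h2
    show |∫ x, ⟪U s x, g x⟫| ≤ B * (eLpNorm g 2 μS).toReal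
    rw [integral_inner_eq_setIntegral_of_eq_zero_off (U s) hg0]
    calc |∫ x in ball x₀ 1, ⟪U s x, g x⟫| ≤ (eLpNorm (U s) 2 μS).toReal * (eLpNorm g 2 μS).toReal :=
          FunctionSpaces.abs_integral_inner_le_eLpNorm_two_mul hs2 (hg2.restrict _)
      _ ≤ B * (eLpNorm g 2 μS).toReal := mul_le_mul_of_nonneg_right hnorm ENNReal.toReal_nonneg
  have hle := eLpNorm_two_le_of_forall_isTestFunctionOn S hw2 hB0 hdual
  -- square
  calc ∫⁻ x in ball x₀ 1, ‖w x‖ₑ ^ 2 = (eLpNorm w 2 μS) ^ 2 := lintegral_enorm_sq_eq_eLpNorm_two_pow μS w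
    _ ≤ (ENNReal.ofReal B) ^ 2 := pow_le_pow_left' hle 2
    _ = C := by
        rw [← ENNReal.ofReal_pow hB0, hB, Real.sq_sqrt C.coe_nonneg, ENNReal.ofReal_coe_nnreal]


/-! ### The weakly continuous representative -/

/-- **The weakly continuous representative of a distributional Navier–Stokes solution with
uniformly local energy on `(0, ∞) × ℝ³`** (Kang–Miura–Tsai 2021, remark after Def. 3.1: "we may
redefine `v` on a set of measure zero in time so that (6) holds"; Seregin 2014, (7.3.6), (7.3.8);
Temam 1977, Ch. III, Lemma 1.4). Let `(U, P)` be a distributional solution on the open slab whose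
slices obey `∫_{B(x₀,1)} |U(t)|² ≤ A(S)` for a.e. `t ∈ (0, S)` and every `x₀`, every `S`, with `A`
monotone. Then there is `U'` with `U'(t) = U(t)` for a.e. `t > 0` (as slices), every slice
`U'(t)`, `t > 0`, measurable with `∫_{B(x₀,1)} |U'(t)|² ≤ A(T)` whenever `t < T`, such that for
every test field `η` and every `t > 0`, `∫⟪U(s), η⟫ → ∫⟪U'(t), η⟫` along a.e. `s → t`, and
`t ↦ ∫⟪U'(t), η⟫` is continuous on `(0, ∞)`: off a null set of good times `U'` is `U`, and at
the remaining times it is the weak trace (`exists_weak_trace`); the pairings of `U'` are the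
essential limits of the pairings of `U` everywhere (at good times by density of countable
families of test fields, `exists_dense_seq_isTestFunctionOn`), which are continuous
(`continuousOn_limUnder_pairing`). [cite: KangMiuraTsai2020, remark after Def. 3.1, and Def. 3.1 (6)] [cite: Seregin2014, Ch. 7 §7.3 (7.3.6), (7.3.8)] -/
theorem exists_weaklyContinuous_representative
    (hsol : IsDistributionalNSSolutionOn (slab (EuclideanSpace ℝ (Fin 3)) (Ioi 0) isOpen_Ioi) ν 0 U P)
    (hUm : AEStronglyMeasurable (uncurry U) (volume.restrict (Ioi (0 : ℝ) ×ˢ (univ : Set (EuclideanSpace ℝ (Fin 3))))))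
    (hAmono : Monotone A)
    (hUA : ∀ S : ℝ, ∀ᵐ t ∂(volume.restrict (Ioo (0 : ℝ) S)), ∀ x₀ : (EuclideanSpace ℝ (Fin 3)),
      ∫⁻ x in ball x₀ 1, ‖U t x‖ₑ ^ 2 ≤ A S) :
    ∃ U' : ℝ → (EuclideanSpace ℝ (Fin 3)) → (EuclideanSpace ℝ (Fin 3)),
      (∀ᵐ t ∂(volume.restrict (Ioi (0 : ℝ))), U' t = U t) ∧
      (∀ t : ℝ, 0 < t → AEStronglyMeasurable (U' t) volume) ∧
      (∀ t T : ℝ, 0 < t → t < T → ∀ x₀ : (EuclideanSpace ℝ (Fin 3)), ∫⁻ x in ball x₀ 1, ‖U' t x‖ₑ ^ 2 ≤ A T) ∧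
      (∀ η : (EuclideanSpace ℝ (Fin 3)) → (EuclideanSpace ℝ (Fin 3)), FunctionSpaces.IsTestFunctionOn (⊤ : Opens (EuclideanSpace ℝ (Fin 3))) η → ∀ t : ℝ, 0 < t →
        Tendsto (fun s => ∫ x, ⟪U s x, η x⟫) (𝓝 t ⊓ ae (volume : Measure ℝ))
          (𝓝 (∫ x, ⟪U' t x, η x⟫))) ∧
      (∀ η : (EuclideanSpace ℝ (Fin 3)) → (EuclideanSpace ℝ (Fin 3)), FunctionSpaces.IsTestFunctionOn (⊤ : Opens (EuclideanSpace ℝ (Fin 3))) η →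
        ContinuousOn (fun t => ∫ x, ⟪U' t x, η x⟫) (Ioi 0)) := by
  haveI : ∀ t : ℝ, (𝓝 t ⊓ ae (volume : Measure ℝ)).NeBot := fun t => nhds_inf_ae_neBot t
  classical
  -- ### the essential limits `W η t` of the pairings
  set W : ((EuclideanSpace ℝ (Fin 3)) → (EuclideanSpace ℝ (Fin 3))) → ℝ → ℝ := fun η t =>
    limUnder (𝓝 t ⊓ ae (volume : Measure ℝ)) (fun s => ∫ x, ⟪U s x, η x⟫) with hW
  have hWlim : ∀ {η : (EuclideanSpace ℝ (Fin 3)) → (EuclideanSpace ℝ (Fin 3))}, FunctionSpaces.IsTestFunctionOn (⊤ : Opens (EuclideanSpace ℝ (Fin 3))) η → ∀ t : ℝ, 0 < t →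
      Tendsto (fun s => ∫ x, ⟪U s x, η x⟫) (𝓝 t ⊓ ae (volume : Measure ℝ)) (𝓝 (W η t)) :=
    fun hη => (continuousOn_limUnder_pairing hsol hη).2.1
  have hWcont : ∀ {η : (EuclideanSpace ℝ (Fin 3)) → (EuclideanSpace ℝ (Fin 3))}, FunctionSpaces.IsTestFunctionOn (⊤ : Opens (EuclideanSpace ℝ (Fin 3))) η →
      ContinuousOn (W η) (Ioi 0) := fun hη => (continuousOn_limUnder_pairing hsol hη).1
  have hWae : ∀ {η : (EuclideanSpace ℝ (Fin 3)) → (EuclideanSpace ℝ (Fin 3))}, FunctionSpaces.IsTestFunctionOn (⊤ : Opens (EuclideanSpace ℝ (Fin 3))) η →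
      ∀ᵐ t ∂(volume.restrict (Ioi (0 : ℝ))), (∫ x, ⟪U t x, η x⟫) = W η t :=
    fun hη => (continuousOn_limUnder_pairing hsol hη).2.2
  -- ### the weak traces at every positive time
  have htr := fun (t : ℝ) (ht : 0 < t) => exists_weak_trace hsol hUm hUA ht
  choose Utr hUtrm hUtr2 hUtrlim using htr
  -- ### countable dense families of test fields on the balls `B(0, m+1)` and unit-ball covers
  have hψex : ∀ m : ℕ, ∃ ψ : ℕ → (EuclideanSpace ℝ (Fin 3)) → (EuclideanSpace ℝ (Fin 3)),
      (∀ i, FunctionSpaces.IsTestFunctionOn (⟨ball (0 : (EuclideanSpace ℝ (Fin 3))) ((m : ℝ) + 1), isOpen_ball⟩ : Opens (EuclideanSpace ℝ (Fin 3))) (ψ i)) ∧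
      ∀ g : (EuclideanSpace ℝ (Fin 3)) → (EuclideanSpace ℝ (Fin 3)), MemLp g 2 (volume.restrict (ball (0 : (EuclideanSpace ℝ (Fin 3))) ((m : ℝ) + 1))) →
        ∀ ε : ℝ≥0∞, ε ≠ 0 → ∃ i, eLpNorm (g - ψ i) 2 (volume.restrict (ball (0 : (EuclideanSpace ℝ (Fin 3))) ((m : ℝ) + 1))) ≤ ε :=
    fun m => exists_dense_seq_isTestFunctionOn ((m : ℝ) + 1)
  choose ψ hψ hdense using hψex
  have hψtop : ∀ m i, FunctionSpaces.IsTestFunctionOn (⊤ : Opens (EuclideanSpace ℝ (Fin 3))) (ψ m i) :=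
    fun m i => (hψ m i).mono le_top
  have hψsupp : ∀ m i, tsupport (ψ m i) ⊆ ball (0 : (EuclideanSpace ℝ (Fin 3))) ((m : ℝ) + 1) := fun m i => (hψ m i).tsupport_subset
  have hFex : ∀ m : ℕ, ∃ F : Finset (EuclideanSpace ℝ (Fin 3)), ball (0 : (EuclideanSpace ℝ (Fin 3))) ((m : ℝ) + 1) ⊆ ⋃ c ∈ F, ball c 1 := fun m => by
    obtain ⟨F, hF⟩ := exists_finset_ball_subset_biUnion_ball_one ((m : ℝ) + 1)
    exact ⟨F, by simpa only [zero_add] using hF 0⟩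
  choose F hF using hFex
  -- ### the good times
  set Good : Set ℝ := {t | AEStronglyMeasurable (U t) volume ∧
      (∀ q : ℚ, t < q → ∀ x₀ : (EuclideanSpace ℝ (Fin 3)), ∫⁻ x in ball x₀ 1, ‖U t x‖ₑ ^ 2 ≤ A q) ∧
      ∀ m i : ℕ, (∫ x, ⟪U t x, ψ m i x⟫) = W (ψ m i) t} with hGood
  have hgood_ae : ∀ᵐ t ∂(volume.restrict (Ioi (0 : ℝ))), t ∈ Good := by
    -- measurability of a.e. slice
    have h1 : ∀ᵐ t ∂(volume.restrict (Ioi (0 : ℝ))), AEStronglyMeasurable (U t) volume := by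
      have hn : ∀ n : ℕ, ∀ᵐ t ∂(volume : Measure ℝ), t ∈ Ioo (0 : ℝ) n → AEStronglyMeasurable (U t) volume := by
        intro n
        have hmeas : AEStronglyMeasurable (uncurry U)
            (volume.restrict (Ioo (0 : ℝ) n ×ˢ (univ : Set (EuclideanSpace ℝ (Fin 3))))) :=
          hUm.mono_measure (Measure.restrict_mono (Set.prod_mono Ioo_subset_Ioi_self Subset.rfl) le_rfl)
        exact (ae_restrict_iff' measurableSet_Ioo).1 (ae_aestronglyMeasurable_slice_of_uncurry hmeas)
      rw [ae_restrict_iff' measurableSet_Ioi]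
      filter_upwards [ae_all_iff.2 hn] with t ht ht0
      obtain ⟨n, hn⟩ := exists_nat_gt t
      exact ht n ⟨ht0, hn⟩
    -- the bounds at rational windows
    have h2 : ∀ᵐ (t : ℝ) ∂(volume.restrict (Ioi (0 : ℝ))), ∀ q : ℚ, t < (q : ℝ) → ∀ x₀ : (EuclideanSpace ℝ (Fin 3)),
        ∫⁻ x in ball x₀ 1, ‖U t x‖ₑ ^ 2 ≤ A q := by
      have hq : ∀ q : ℚ, ∀ᵐ t ∂(volume : Measure ℝ), t ∈ Ioo (0 : ℝ) (q : ℝ) → ∀ x₀ : (EuclideanSpace ℝ (Fin 3)),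
          ∫⁻ x in ball x₀ 1, ‖U t x‖ₑ ^ 2 ≤ A q := fun q =>
        (ae_restrict_iff' measurableSet_Ioo).1 (hUA (q : ℝ))
      rw [ae_restrict_iff' measurableSet_Ioi]
      filter_upwards [ae_all_iff.2 hq] with t ht ht0 q htq
      exact ht q ⟨ht0, htq⟩
    -- the pairings against the countable families
    have h3 : ∀ᵐ t ∂(volume.restrict (Ioi (0 : ℝ))), ∀ m i : ℕ, (∫ x, ⟪U t x, ψ m i x⟫) = W (ψ m i) t :=
      ae_all_iff.2 fun m => ae_all_iff.2 fun i => hWae (hψtop m i)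
    filter_upwards [h1, h2, h3] with t ht1 ht2 ht3
    exact ⟨ht1, ht2, ht3⟩
  -- a measurable null set containing the bad positive times
  set Bad : Set ℝ := {t | 0 < t ∧ t ∉ Good} with hBad
  have hBad0 : volume Bad = 0 := by
    have h1 : ∀ᵐ t ∂(volume : Measure ℝ), t ∉ Bad := by
      have h2 := (ae_restrict_iff' measurableSet_Ioi).1 hgood_ae
      filter_upwards [h2] with t ht
      rintro ⟨ht0, htg⟩
      exact htg (ht ht0)
    simpa [ae_iff] using h1
  set N : Set ℝ := toMeasurable volume Bad with hN
  have hNm : MeasurableSet N := measurableSet_toMeasurable _ _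
  have hN0 : volume N = 0 := by rw [hN, measure_toMeasurable]; exact hBad0
  have hBadN : Bad ⊆ N := subset_toMeasurable _ _
  have hgoodN : ∀ t : ℝ, 0 < t → t ∉ N → t ∈ Good := fun t ht htN => by
    by_contra h
    exact htN (hBadN ⟨ht, h⟩)
  -- ### properties of good times
  -- the bound `A T` for `t < T`
  have hgood_bound : ∀ t : ℝ, t ∈ Good → ∀ T : ℝ, t < T → ∀ x₀ : (EuclideanSpace ℝ (Fin 3)),
      ∫⁻ x in ball x₀ 1, ‖U t x‖ₑ ^ 2 ≤ A T := by
    intro t ht T htT x₀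
    obtain ⟨q, htq, hqT⟩ := exists_rat_btwn htT
    exact (ht.2.1 q htq x₀).trans (ENNReal.coe_le_coe.2 (hAmono hqT.le))
  -- the pairing identity for every test field, by density
  have hgood_pair : ∀ t : ℝ, 0 < t → t ∈ Good → ∀ η : (EuclideanSpace ℝ (Fin 3)) → (EuclideanSpace ℝ (Fin 3)),
      FunctionSpaces.IsTestFunctionOn (⊤ : Opens (EuclideanSpace ℝ (Fin 3))) η → (∫ x, ⟪U t x, η x⟫) = W η t := by
    intro t ht0 ht η hη
    -- a ball `B(0, m+1)` containing the support of `η`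
    obtain ⟨r, hr⟩ := hη.hasCompactSupport.isCompact.isBounded.subset_ball (0 : (EuclideanSpace ℝ (Fin 3)))
    set m : ℕ := ⌈r⌉₊ with hm
    have hrm : r ≤ (m : ℝ) + 1 := (Nat.le_ceil r).trans (by rw [hm]; linarith)
    have hηm : tsupport η ⊆ ball (0 : (EuclideanSpace ℝ (Fin 3))) ((m : ℝ) + 1) := hr.trans (ball_subset_ball hrm)
    have hη2 : MemLp η 2 volume := hη.contDiff.continuous.memLp_of_hasCompactSupport hη.hasCompactSupport
    -- the constant: bounds `A (t+1)` at `t` and along a.e. `s → t`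
    set C : ℝ≥0 := A (t + 1) with hC
    set K : ℝ := Real.sqrt ((F m).card * C) with hK
    have hK0 : 0 ≤ K := Real.sqrt_nonneg _
    have hbt : ∀ x₀ : (EuclideanSpace ℝ (Fin 3)), ∫⁻ x in ball x₀ 1, ‖U t x‖ₑ ^ 2 ≤ C := hgood_bound t ht (t + 1) (lt_add_one t)
    -- good slices along the filter
    have hev : ∀ᶠ s in 𝓝 t ⊓ ae (volume : Measure ℝ), AEStronglyMeasurable (U s) volume ∧
        ∀ x₀ : (EuclideanSpace ℝ (Fin 3)), ∫⁻ x in ball x₀ 1, ‖U s x‖ₑ ^ 2 ≤ C := by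
      obtain ⟨N₀, hN'⟩ := eventually_good_slice hUm hUA ht0 0
      filter_upwards [hN'] with s hs using ⟨hs.1, hs.2.1⟩
    -- `|W η t - W ψ t| ≤ K ‖η - ψ‖` for `ψ = ψ m i`
    have hWdiff : ∀ i, |W η t - W (ψ m i) t| ≤
        K * (eLpNorm (η - ψ m i) 2 (volume.restrict (ball (0 : (EuclideanSpace ℝ (Fin 3))) ((m : ℝ) + 1)))).toReal := by
      intro i
      have hlim := ((continuous_abs.tendsto _).comp ((hWlim hη t ht0).sub (hWlim (hψtop m i) t ht0)))
      refine le_of_tendsto hlim ?_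
      filter_upwards [hev] with s hs
      exact abs_integral_inner_sub_le_of_bound hs.1 hs.2 (hF m) hη (hψtop m i) hηm (hψsupp m i)
    -- `|g η t - g ψ t| ≤ K ‖η - ψ‖`
    have hgdiff : ∀ i, |(∫ x, ⟪U t x, η x⟫) - ∫ x, ⟪U t x, ψ m i x⟫| ≤
        K * (eLpNorm (η - ψ m i) 2 (volume.restrict (ball (0 : (EuclideanSpace ℝ (Fin 3))) ((m : ℝ) + 1)))).toReal := fun i =>
      abs_integral_inner_sub_le_of_bound ht.1 hbt (hF m) hη (hψtop m i) hηm (hψsupp m i)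
    -- conclude: the difference is `≤ 2 K ε` for every `ε > 0`
    refine eq_of_abs_sub_le_all (fun ε hε => ?_)
    set δ : ℝ := ε / (2 * (K + 1)) with hδ
    have hδ0 : 0 < δ := by rw [hδ]; positivity
    obtain ⟨i, hi⟩ := hdense m η (hη2.restrict _) (ENNReal.ofReal δ) (by simpa using hδ0)
    have hi' : (eLpNorm (η - ψ m i) 2 (volume.restrict (ball (0 : (EuclideanSpace ℝ (Fin 3))) ((m : ℝ) + 1)))).toReal ≤ δ :=
      ENNReal.toReal_le_of_le_ofReal hδ0.le hi
    have e : (∫ x, ⟪U t x, η x⟫) - W η t =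
        ((∫ x, ⟪U t x, η x⟫) - ∫ x, ⟪U t x, ψ m i x⟫) + ((∫ x, ⟪U t x, ψ m i x⟫) - W (ψ m i) t) -
          (W η t - W (ψ m i) t) := by ring
    have hmid : (∫ x, ⟪U t x, ψ m i x⟫) - W (ψ m i) t = 0 := sub_eq_zero.2 (ht.2.2 m i)
    rw [e, hmid, add_zero]
    calc |((∫ x, ⟪U t x, η x⟫) - ∫ x, ⟪U t x, ψ m i x⟫) - (W η t - W (ψ m i) t)|
        ≤ |(∫ x, ⟪U t x, η x⟫) - ∫ x, ⟪U t x, ψ m i x⟫| + |W η t - W (ψ m i) t| := abs_sub _ _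
      _ ≤ K * δ + K * δ := add_le_add ((hgdiff i).trans (mul_le_mul_of_nonneg_left hi' hK0))
          ((hWdiff i).trans (mul_le_mul_of_nonneg_left hi' hK0))
      _ ≤ (K + 1) * δ + (K + 1) * δ := by gcongr <;> linarith
      _ = ε := by rw [hδ]; field_simp; ring
  -- ### the representative
  set U' : ℝ → (EuclideanSpace ℝ (Fin 3)) → (EuclideanSpace ℝ (Fin 3)) := fun t => if ht : 0 < t ∧ t ∈ N then Utr t ht.1 else U t with hU'
  have hU'good : ∀ t : ℝ, t ∉ N → U' t = U t := fun t ht => by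
    simp only [hU']
    split_ifs with h
    · exact absurd h.2 ht
    · rfl
  have hU'bad : ∀ t : ℝ, ∀ ht : 0 < t, t ∈ N → U' t = Utr t ht := fun t ht htN => by
    simp only [hU']
    split_ifs with h
    · rfl
    · exact absurd ⟨ht, htN⟩ h
  -- the pairings of `U'` are the essential limits, at every positive time
  have hU'pair : ∀ η : (EuclideanSpace ℝ (Fin 3)) → (EuclideanSpace ℝ (Fin 3)), FunctionSpaces.IsTestFunctionOn (⊤ : Opens (EuclideanSpace ℝ (Fin 3))) η → ∀ t : ℝ, 0 < t →
      (∫ x, ⟪U' t x, η x⟫) = W η t := by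
    intro η hη t ht
    by_cases htN : t ∈ N
    · rw [hU'bad t ht htN]
      exact tendsto_nhds_unique (hUtrlim t ht η hη) (hWlim hη t ht)
    · rw [hU'good t htN]
      exact hgood_pair t ht (hgoodN t ht htN) η hη
  refine ⟨U', ?_, ?_, ?_, ?_, ?_⟩
  · -- `U' = U` at a.e. positive time
    have h1 : ∀ᵐ t ∂(volume : Measure ℝ), t ∉ N := by
      rw [ae_iff]; simp only [not_not, setOf_mem_eq]; exact hN0
    filter_upwards [ae_restrict_of_ae (s := Ioi (0 : ℝ)) h1] with t ht using hU'good t ht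
  · -- measurability of the slices
    intro t ht
    by_cases htN : t ∈ N
    · rw [hU'bad t ht htN]; exact (hUtrm t ht).aestronglyMeasurable
    · rw [hU'good t htN]; exact (hgoodN t ht htN).1
  · -- the every-time bound
    intro t T ht htT x₀
    by_cases htN : t ∈ N
    · rw [hU'bad t ht htN]
      have hw2 : ∀ x₁ : (EuclideanSpace ℝ (Fin 3)), MemLp (Utr t ht) 2 (volume.restrict (ball x₁ 1)) := by
        intro x₁
        set k : ℕ := ⌈‖x₁‖⌉₊ + 2 with hk
        have hsub : ball x₁ 1 ⊆ ball (0 : (EuclideanSpace ℝ (Fin 3))) k := by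
          intro y hy
          rw [mem_ball_zero_iff]
          rw [mem_ball, dist_eq_norm] at hy
          have h1 : ‖y‖ ≤ ‖y - x₁‖ + ‖x₁‖ := norm_le_norm_sub_add y x₁
          have h2 : ‖x₁‖ ≤ ⌈‖x₁‖⌉₊ := Nat.le_ceil _
          have h3 : (k : ℝ) = ⌈‖x₁‖⌉₊ + 2 := by rw [hk]; push_cast; ring
          linarith
        exact (hUtr2 t ht k).mono_measure (Measure.restrict_mono hsub le_rfl)
      -- good slices with bound `A T` along a.e. `s → t` (window `(0, T) ∋ t`)
      have hev : ∀ᶠ s in 𝓝 t ⊓ ae (volume : Measure ℝ), AEStronglyMeasurable (U s) volume ∧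
          ∀ x₁ : (EuclideanSpace ℝ (Fin 3)), ∫⁻ x in ball x₁ 1, ‖U s x‖ₑ ^ 2 ≤ A T := by
        obtain ⟨N₀, hN'⟩ := eventually_good_slice hUm hUA ht 0
        have hI : ∀ᶠ s in 𝓝 t ⊓ ae (volume : Measure ℝ), s ∈ Ioo 0 T :=
          mem_inf_of_left (Ioo_mem_nhds ht htT)
        have hb := mem_inf_of_right (f := 𝓝 t) ((ae_restrict_iff' measurableSet_Ioo).1 (hUA T))
        filter_upwards [hN', hI, hb] with s hs hsI hsb using ⟨hs.1, hsb hsI⟩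
      have hev' : ∀ᶠ s in 𝓝 t ⊓ ae (volume : Measure ℝ), AEStronglyMeasurable (U s) volume ∧
          ∫⁻ x in ball x₀ 1, ‖U s x‖ₑ ^ 2 ≤ A T := by
        filter_upwards [hev] with s hs using ⟨hs.1, hs.2 x₀⟩
      exact lintegral_unitBall_le_of_tendsto_pairing x₀ (hw2 x₀) hev' (hUtrlim t ht)
    · rw [hU'good t htN]
      exact hgood_bound t (hgoodN t ht htN) T htT x₀
  · -- the essential limits of the pairings of `U` are the pairings of `U'`
    intro η hη t ht
    rw [hU'pair η hη t ht]
    exact hWlim hη t ht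
  · -- weak continuity on `(0, ∞)`
    intro η hη
    refine (hWcont hη).congr fun t ht => ?_
    exact hU'pair η hη t ht


/-! ### Equicontinuity of the pairings: the flux bound with a.e.-in-time local energy control -/

/-- **The flux is controlled by the gauged integrand, integrated over the strip** (copy of
`IsLocalEnergySolutionOn.lintegral_enorm_pairingFlux_le` for a distributional solution on the slab
`(0, ∞) × ℝ³`): for a test field `η` supported in `B(0, R)` with `|Dη| ≤ K₁`, `|Δη| ≤ K₂`, a
measurable gauge `c` and `0 < s ≤ t`,
`∫_{]s,t]} |f_η| ≤ K₁ ∫∫_S |v|² + ν K₂ ∫∫_S |v| + 3 K₁ ∫∫_S |π − c|`, `S = ]s,t] × B(0,R)`. [folklore] -/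
theorem lintegral_enorm_pairingFlux_le_slab {v : ℝ → (EuclideanSpace ℝ (Fin 3)) → (EuclideanSpace ℝ (Fin 3))} {π : ℝ → (EuclideanSpace ℝ (Fin 3)) → ℝ}
    (hsol : IsDistributionalNSSolutionOn (slab (EuclideanSpace ℝ (Fin 3)) (Ioi 0) isOpen_Ioi) ν 0 v π) (hν : 0 ≤ ν)
    {η : (EuclideanSpace ℝ (Fin 3)) → (EuclideanSpace ℝ (Fin 3))} (hη : FunctionSpaces.IsTestFunctionOn (⊤ : Opens (EuclideanSpace ℝ (Fin 3))) η) {R K₁ K₂ : ℝ}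
    (hηR : tsupport η ⊆ ball (0 : (EuclideanSpace ℝ (Fin 3))) R)
    (hK₁ : ∀ x, ‖fderiv ℝ η x‖ ≤ K₁) (hK₂ : ∀ x, ‖Δ η x‖ ≤ K₂) {c : ℝ → ℝ} (hc : Measurable c)
    {s t : ℝ} (hs : 0 < s) :
    ∫⁻ τ in Ioc s t, ‖pairingFlux ν v π η τ‖ₑ ≤
      ENNReal.ofReal K₁ * (∫⁻ z in Ioc s t ×ˢ ball (0 : (EuclideanSpace ℝ (Fin 3))) R, ‖v z.1 z.2‖ₑ ^ 2) +
        ENNReal.ofReal (ν * K₂) * (∫⁻ z in Ioc s t ×ˢ ball (0 : (EuclideanSpace ℝ (Fin 3))) R, ‖v z.1 z.2‖ₑ) +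
        ENNReal.ofReal (3 * K₁) * (∫⁻ z in Ioc s t ×ˢ ball (0 : (EuclideanSpace ℝ (Fin 3))) R, ‖π z.1 z.2 - c z.1‖ₑ) := by
  -- the gauged integrand
  set Gg : ℝ × (EuclideanSpace ℝ (Fin 3)) → ℝ := fun z =>
    ⟪v z.1 z.2, fderiv ℝ η z.2 (v z.1 z.2)⟫ + ν * ⟪v z.1 z.2, Δ η z.2⟫ +
      (π z.1 z.2 - c z.1) * VectorCalculus.divergence η z.2 with hGg
  -- (i) `f τ = ∫ Gg (τ, ·)` with integrable integrand, for a.e. `τ ∈ ]s, t]`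
  set a' : ℝ := s / 2 with ha'
  set b' : ℝ := t + 1 with hb'
  have ha'0 : 0 < a' := by rw [ha']; linarith
  have hsub' : Ioc s t ⊆ Ioo a' b' := fun τ hτ =>
    ⟨by rw [ha']; linarith [hτ.1], by rw [hb']; linarith [hτ.2]⟩
  obtain ⟨-, iG⟩ := hsol.integrable_pairing_strip ha'0 (b := b') hη
  have cD : Continuous (fderiv ℝ η) := hη.contDiff.continuous_fderiv (by simp)
  have cdiv : Continuous (VectorCalculus.divergence η) := continuous_divergence cD
  have hdivc : HasCompactSupport (VectorCalculus.divergence η) := by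
    refine HasCompactSupport.intro hη.hasCompactSupport fun x hx => ?_
    have h1 : fderiv ℝ η x = 0 := fderiv_of_notMem_tsupport ℝ hx
    simp [VectorCalculus.divergence, h1]
  have hdivI : Integrable (VectorCalculus.divergence η) volume := cdiv.integrable_of_hasCompactSupport hdivc
  have hdiv0 : ∫ x, VectorCalculus.divergence η x = 0 :=
    integral_divergence_eq_zero (hη.contDiff.of_le (by exact_mod_cast le_top)) hη.hasCompactSupport
  have hae1 : ∀ᵐ τ ∂(volume.restrict (Ioc s t)), ‖pairingFlux ν v π η τ‖ₑ ≤ ∫⁻ x, ‖Gg (τ, x)‖ₑ := by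
    have h1 : ∀ᵐ τ ∂(volume.restrict (Ioo a' b')),
        Integrable (fun x => ⟪v τ x, fderiv ℝ η x (v τ x)⟫ + ν * ⟪v τ x, Δ η x⟫ +
          π τ x * VectorCalculus.divergence η x) volume := iG.prod_right_ae
    filter_upwards [ae_restrict_of_ae_restrict_of_subset hsub' h1] with τ hτ
    have e : (fun x => Gg (τ, x)) = fun x => (⟪v τ x, fderiv ℝ η x (v τ x)⟫ +
        ν * ⟪v τ x, Δ η x⟫ + π τ x * VectorCalculus.divergence η x) -
        c τ * VectorCalculus.divergence η x := by
      funext x; simp only [hGg]; ring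
    have hfeq : pairingFlux ν v π η τ = ∫ x, Gg (τ, x) := by
      rw [pairingFlux_def, e, integral_sub hτ (hdivI.const_mul _), MeasureTheory.integral_const_mul,
        hdiv0, mul_zero, sub_zero]
    rw [hfeq]
    exact enorm_integral_le_lintegral_enorm _
  -- (ii) measurability on the strip `]s, t] × ℝ³`
  set S : Set (ℝ × (EuclideanSpace ℝ (Fin 3))) := Ioc s t ×ˢ ball (0 : (EuclideanSpace ℝ (Fin 3))) R with hS_def
  have hIoc : Ioc s t ⊆ Ioi 0 := fun τ hτ => hs.trans hτ.1
  have hstrip : Ioc s t ×ˢ (univ : Set (EuclideanSpace ℝ (Fin 3))) ⊆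
      ((slab (EuclideanSpace ℝ (Fin 3)) (Ioi 0) isOpen_Ioi : Opens (ℝ × (EuclideanSpace ℝ (Fin 3)))) : Set (ℝ × (EuclideanSpace ℝ (Fin 3)))) := by
    rw [coe_slab]; exact Set.prod_mono hIoc Subset.rfl
  have hμ : ((volume : Measure ℝ).restrict (Ioc s t)).prod (volume : Measure (EuclideanSpace ℝ (Fin 3))) =
      volume.restrict (Ioc s t ×ˢ (univ : Set (EuclideanSpace ℝ (Fin 3)))) := by
    conv_lhs => rw [← Measure.restrict_univ (μ := (volume : Measure (EuclideanSpace ℝ (Fin 3))))]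
    rw [Measure.prod_restrict, ← Measure.volume_eq_prod]
  have hvm : AEStronglyMeasurable (uncurry v) (volume.restrict (Ioc s t ×ˢ (univ : Set (EuclideanSpace ℝ (Fin 3))))) :=
    (hsol.1.aestronglyMeasurable).mono_measure (Measure.restrict_mono hstrip le_rfl)
  have hπm : AEStronglyMeasurable (uncurry π) (volume.restrict (Ioc s t ×ˢ (univ : Set (EuclideanSpace ℝ (Fin 3))))) :=
    (hsol.2.2.1.aestronglyMeasurable).mono_measure (Measure.restrict_mono hstrip le_rfl)
  have hcm : AEStronglyMeasurable (fun z : ℝ × (EuclideanSpace ℝ (Fin 3)) => c z.1) (volume.restrict (Ioc s t ×ˢ (univ : Set (EuclideanSpace ℝ (Fin 3))))) :=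
    (hc.comp measurable_fst).aestronglyMeasurable
  have hGgm : AEStronglyMeasurable Gg (volume.restrict (Ioc s t ×ˢ (univ : Set (EuclideanSpace ℝ (Fin 3))))) := by
    have cL : Continuous (Δ η) := continuous_laplacian (hη.contDiff.of_le (by norm_cast))
    refine ((hvm.inner (isBoundedBilinearMap_apply.continuous.comp_aestronglyMeasurable
      ((cD.comp continuous_snd).aestronglyMeasurable.prodMk hvm))).add
      ((hvm.inner (cL.comp continuous_snd).aestronglyMeasurable).const_mul ν)).add
      ((hπm.sub hcm).mul (cdiv.comp continuous_snd).aestronglyMeasurable)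
  have hmS : volume.restrict S ≤ volume.restrict (Ioc s t ×ˢ (univ : Set (EuclideanSpace ℝ (Fin 3)))) :=
    Measure.restrict_mono (Set.prod_mono Subset.rfl (subset_univ _)) le_rfl
  have m1 : AEMeasurable (fun z : ℝ × (EuclideanSpace ℝ (Fin 3)) => ‖v z.1 z.2‖ₑ ^ 2) (volume.restrict S) :=
    (hvm.enorm.pow_const 2).mono_measure hmS
  have m2 : AEMeasurable (fun z : ℝ × (EuclideanSpace ℝ (Fin 3)) => ‖v z.1 z.2‖ₑ) (volume.restrict S) := hvm.enorm.mono_measure hmS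
  have m3 : AEMeasurable (fun z : ℝ × (EuclideanSpace ℝ (Fin 3)) => ‖π z.1 z.2 - c z.1‖ₑ) (volume.restrict S) :=
    (hπm.sub hcm).enorm.mono_measure hmS
  -- (iii) Tonelli and the pointwise bound
  set H : ℝ × (EuclideanSpace ℝ (Fin 3)) → ℝ≥0∞ := fun z =>
    ENNReal.ofReal K₁ * ‖v z.1 z.2‖ₑ ^ 2 + ENNReal.ofReal (ν * K₂) * ‖v z.1 z.2‖ₑ +
      ENNReal.ofReal (3 * K₁) * ‖π z.1 z.2 - c z.1‖ₑ with hH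
  calc ∫⁻ τ in Ioc s t, ‖pairingFlux ν v π η τ‖ₑ
      ≤ ∫⁻ τ in Ioc s t, ∫⁻ x, ‖Gg (τ, x)‖ₑ := lintegral_mono_ae hae1
    _ = ∫⁻ z, ‖Gg z‖ₑ ∂(((volume : Measure ℝ).restrict (Ioc s t)).prod (volume : Measure (EuclideanSpace ℝ (Fin 3)))) := by
        rw [lintegral_prod _ (by rw [hμ]; exact hGgm.enorm)]
    _ ≤ ∫⁻ z, (univ ×ˢ ball (0 : (EuclideanSpace ℝ (Fin 3))) R).indicator H z
          ∂(((volume : Measure ℝ).restrict (Ioc s t)).prod (volume : Measure (EuclideanSpace ℝ (Fin 3)))) :=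
        lintegral_mono fun z => enorm_gaugedFlux_le hν hηR hK₁ hK₂ z
    _ = ∫⁻ z in S, H z := by
        rw [hμ, lintegral_indicator (MeasurableSet.univ.prod measurableSet_ball),
          Measure.restrict_restrict (MeasurableSet.univ.prod measurableSet_ball),
          prod_inter_prod, univ_inter, inter_univ]
    _ = ENNReal.ofReal K₁ * (∫⁻ z in S, ‖v z.1 z.2‖ₑ ^ 2) +
          ENNReal.ofReal (ν * K₂) * (∫⁻ z in S, ‖v z.1 z.2‖ₑ) +
          ENNReal.ofReal (3 * K₁) * (∫⁻ z in S, ‖π z.1 z.2 - c z.1‖ₑ) := by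
        simp only [hH]
        rw [lintegral_add_left' (f := fun z : ℝ × (EuclideanSpace ℝ (Fin 3)) =>
            ENNReal.ofReal K₁ * ‖v z.1 z.2‖ₑ ^ 2 + ENNReal.ofReal (ν * K₂) * ‖v z.1 z.2‖ₑ)
            ((m1.const_mul _).add (m2.const_mul _)),
          lintegral_add_left' (f := fun z : ℝ × (EuclideanSpace ℝ (Fin 3)) => ENNReal.ofReal K₁ * ‖v z.1 z.2‖ₑ ^ 2) (m1.const_mul _),
          lintegral_const_mul'' _ m1, lintegral_const_mul'' _ m2, lintegral_const_mul'' _ m3]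

/-- **The three strip integrals under an a.e.-in-time unit-ball bound** (copy of
`IsLocalEnergySolutionOn.strip_lintegral_bounds`): with a unit-ball cover `F` of `B(0,R)`, the
a.e.-in-time unit-ball bound `C` on `(0,T)` and the gauged-pressure bound `D` on `(0,T) × B(0,R)`,
for `0 < s`, `t ≤ T`: `∫∫_S |v|² ≤ |F| C (t − s)`, `∫∫_S |v| ≤ (|F| C (t−s))^{1/2} ((t−s)|B_R|)^{1/2}`,
`∫∫_S |π − c| ≤ D^{2/3} ((t−s)|B_R|)^{1/3}` (`S = ]s,t] × B(0,R)`; Tonelli and Hölder). [folklore] -/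
theorem strip_lintegral_bounds_slab {v : ℝ → (EuclideanSpace ℝ (Fin 3)) → (EuclideanSpace ℝ (Fin 3))} {π : ℝ → (EuclideanSpace ℝ (Fin 3)) → ℝ}
    (hsol : IsDistributionalNSSolutionOn (slab (EuclideanSpace ℝ (Fin 3)) (Ioi 0) isOpen_Ioi) ν 0 v π) {T : ℝ} {C D : ℝ≥0}
    (hC : ∀ᵐ τ ∂(volume.restrict (Ioo (0 : ℝ) T)), ∀ x₀ : (EuclideanSpace ℝ (Fin 3)), ∫⁻ x in ball x₀ 1, ‖v τ x‖ₑ ^ 2 ≤ C)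
    {R : ℝ} {F : Finset (EuclideanSpace ℝ (Fin 3))} (hF : ball (0 : (EuclideanSpace ℝ (Fin 3))) R ⊆ ⋃ c ∈ F, ball c 1) {c : ℝ → ℝ} (hc : Measurable c)
    (hD : ∫⁻ z in Ioo 0 T ×ˢ ball (0 : (EuclideanSpace ℝ (Fin 3))) R, ‖π z.1 z.2 - c z.1‖ₑ ^ (3 / 2 : ℝ) ≤ D)
    {s t : ℝ} (hs : 0 < s) (htT : t ≤ T) :
    (∫⁻ z in Ioc s t ×ˢ ball (0 : (EuclideanSpace ℝ (Fin 3))) R, ‖v z.1 z.2‖ₑ ^ 2) ≤ (F.card * C : ℝ≥0∞) * ENNReal.ofReal (t - s) ∧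
      (∫⁻ z in Ioc s t ×ˢ ball (0 : (EuclideanSpace ℝ (Fin 3))) R, ‖v z.1 z.2‖ₑ) ≤
        ((F.card * C : ℝ≥0∞) * ENNReal.ofReal (t - s)) ^ (1 / 2 : ℝ) *
          (ENNReal.ofReal (t - s) * volume (ball (0 : (EuclideanSpace ℝ (Fin 3))) R)) ^ (1 / 2 : ℝ) ∧
      (∫⁻ z in Ioc s t ×ˢ ball (0 : (EuclideanSpace ℝ (Fin 3))) R, ‖π z.1 z.2 - c z.1‖ₑ) ≤
        (D : ℝ≥0∞) ^ (2 / 3 : ℝ) * (ENNReal.ofReal (t - s) * volume (ball (0 : (EuclideanSpace ℝ (Fin 3))) R)) ^ (1 / 3 : ℝ) := by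
  set S : Set (ℝ × (EuclideanSpace ℝ (Fin 3))) := Ioc s t ×ˢ ball (0 : (EuclideanSpace ℝ (Fin 3))) R with hS_def
  have hIoc' : Ioc s t ⊆ Ioi 0 := fun τ hτ => hs.trans hτ.1
  have hstrip : Ioc s t ×ˢ (univ : Set (EuclideanSpace ℝ (Fin 3))) ⊆ ((slab (EuclideanSpace ℝ (Fin 3)) (Ioi 0) isOpen_Ioi : Opens (ℝ × (EuclideanSpace ℝ (Fin 3)))) : Set (ℝ × (EuclideanSpace ℝ (Fin 3)))) := by
    rw [coe_slab]; exact Set.prod_mono hIoc' Subset.rfl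
  -- `S` lies in `(0,T] × B(0,R)`, which differs from the box `(0,T) × B(0,R)` by a null set
  have hSsub : volume.restrict S ≤ volume.restrict (Ioo 0 T ×ˢ ball (0 : (EuclideanSpace ℝ (Fin 3))) R) := by
    have h1 : S ⊆ Ioo 0 T ×ˢ ball (0 : (EuclideanSpace ℝ (Fin 3))) R ∪ {T} ×ˢ ball (0 : (EuclideanSpace ℝ (Fin 3))) R := by
      rintro ⟨τ, x⟩ ⟨hτ, hx⟩
      rcases lt_or_eq_of_le (hτ.2.trans htT) with h | h
      · exact Or.inl ⟨⟨hs.trans hτ.1, h⟩, hx⟩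
      · exact Or.inr ⟨h, hx⟩
    have hnull : volume ({T} ×ˢ ball (0 : (EuclideanSpace ℝ (Fin 3))) R) = 0 := by
      rw [Measure.volume_eq_prod, Measure.prod_prod, Real.volume_singleton, zero_mul]
    calc volume.restrict S ≤ volume.restrict (Ioo 0 T ×ˢ ball (0 : (EuclideanSpace ℝ (Fin 3))) R ∪ {T} ×ˢ ball (0 : (EuclideanSpace ℝ (Fin 3))) R) :=
          Measure.restrict_mono h1 le_rfl
      _ = volume.restrict (Ioo 0 T ×ˢ ball (0 : (EuclideanSpace ℝ (Fin 3))) R) :=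
          Measure.restrict_congr_set (union_ae_eq_left_of_ae_eq_empty (ae_eq_empty.2 hnull))
  have hmS : volume.restrict S ≤ volume.restrict (Ioc s t ×ˢ (univ : Set (EuclideanSpace ℝ (Fin 3)))) :=
    Measure.restrict_mono (Set.prod_mono Subset.rfl (subset_univ _)) le_rfl
  have hvm : AEStronglyMeasurable (uncurry v) (volume.restrict S) :=
    ((hsol.1.aestronglyMeasurable).mono_measure (Measure.restrict_mono hstrip le_rfl)).mono_measure hmS
  have hπm : AEStronglyMeasurable (fun z : ℝ × (EuclideanSpace ℝ (Fin 3)) => π z.1 z.2 - c z.1) (volume.restrict S) :=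
    (((hsol.2.2.1.aestronglyMeasurable).mono_measure (Measure.restrict_mono hstrip le_rfl)).sub
      (hc.comp measurable_fst).aestronglyMeasurable).mono_measure hmS
  have hvolS : volume S = ENNReal.ofReal (t - s) * volume (ball (0 : (EuclideanSpace ℝ (Fin 3))) R) := by
    rw [hS_def, Measure.volume_eq_prod, Measure.prod_prod, Real.volume_Ioc]
  -- `I₁`
  have hI1 : ∫⁻ z in S, ‖v z.1 z.2‖ₑ ^ 2 ≤ (F.card * C : ℝ≥0∞) * ENNReal.ofReal (t - s) := by
    have hμS : ((volume : Measure ℝ).restrict (Ioc s t)).prod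
        ((volume : Measure (EuclideanSpace ℝ (Fin 3))).restrict (ball 0 R)) = volume.restrict S := by
      rw [Measure.prod_restrict, ← Measure.volume_eq_prod]
    have hinner : ∀ᵐ τ ∂(volume.restrict (Ioc s t)),
        ∫⁻ x in ball (0 : (EuclideanSpace ℝ (Fin 3))) R, ‖v τ x‖ₑ ^ 2 ≤ F.card * C := by
      have hle : volume.restrict (Ioc s t) ≤ volume.restrict (Ioo (0 : ℝ) T) := by
        have h1 : Ioc s t ⊆ Ioo 0 T ∪ {T} := by
          intro τ hτ
          rcases lt_or_eq_of_le (hτ.2.trans htT) with h | h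
          · exact Or.inl ⟨hs.trans hτ.1, h⟩
          · exact Or.inr h
        calc volume.restrict (Ioc s t) ≤ volume.restrict (Ioo (0 : ℝ) T ∪ {T}) := Measure.restrict_mono h1 le_rfl
          _ = volume.restrict (Ioo (0 : ℝ) T) :=
              Measure.restrict_congr_set (union_ae_eq_left_of_ae_eq_empty (ae_eq_empty.2 Real.volume_singleton))
      filter_upwards [ae_mono hle hC] with τ hτ
      exact lintegral_ball_le_card_mul hτ hF
    have hm' : AEMeasurable (fun z : ℝ × (EuclideanSpace ℝ (Fin 3)) => ‖v z.1 z.2‖ₑ ^ 2)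
        (((volume : Measure ℝ).restrict (Ioc s t)).prod ((volume : Measure (EuclideanSpace ℝ (Fin 3))).restrict (ball 0 R))) := by
      rw [hμS]; exact hvm.enorm.pow_const 2
    calc ∫⁻ z in S, ‖v z.1 z.2‖ₑ ^ 2
        = ∫⁻ τ in Ioc s t, ∫⁻ x in ball (0 : (EuclideanSpace ℝ (Fin 3))) R, ‖v τ x‖ₑ ^ 2 := by
          rw [← hμS, lintegral_prod _ hm']
      _ ≤ ∫⁻ _ in Ioc s t, (F.card * C : ℝ≥0∞) := lintegral_mono_ae hinner
      _ = (F.card * C : ℝ≥0∞) * ENNReal.ofReal (t - s) := by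
          rw [setLIntegral_const, Real.volume_Ioc]
  refine ⟨hI1, ?_, ?_⟩
  · -- `I₂` by Cauchy–Schwarz
    have h2 := setLIntegral_enorm_le_rpow_mul_measure_rpow (μ := volume) hvm (q := 2) (by norm_num)
    rw [show (1 - 1 / 2 : ℝ) = 1 / 2 by norm_num, hvolS] at h2
    refine h2.trans ?_
    gcongr
    calc ∫⁻ x in S, ‖uncurry v x‖ₑ ^ (2 : ℝ) = ∫⁻ z in S, ‖v z.1 z.2‖ₑ ^ 2 :=
          lintegral_congr fun z => by rw [ENNReal.rpow_two]; rfl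
      _ ≤ _ := hI1
  · -- `I₃` by Hölder with exponents `3/2` and `3`
    have h3 := setLIntegral_enorm_le_rpow_mul_measure_rpow (μ := volume) hπm (q := 3 / 2) (by norm_num)
    rw [show (1 / (3 / 2) : ℝ) = 2 / 3 by norm_num, show (1 - 2 / 3 : ℝ) = 1 / 3 by norm_num, hvolS] at h3
    refine h3.trans ?_
    gcongr
    exact (lintegral_mono' hSsub le_rfl).trans hD

/-- **The core increment estimate for a version with the flux as derivative** (copy of
`IsLocalEnergySolutionOn.abs_integral_inner_sub_le_core`): if `V t − V s = ∫_{]s,t]} f_η`, then for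
`0 < s < t ≤ T`, with `N = |F|` and `V_R = |B(0,R)|`,
`|V t − V s| ≤ K₁ N C (t−s) + ν K₂ (N C V_R)^{1/2} (t−s) + 3K₁ D^{2/3} V_R^{1/3} (t−s)^{1/3}`. [folklore] -/
theorem abs_sub_le_core_slab {v : ℝ → (EuclideanSpace ℝ (Fin 3)) → (EuclideanSpace ℝ (Fin 3))} {π : ℝ → (EuclideanSpace ℝ (Fin 3)) → ℝ}
    (hsol : IsDistributionalNSSolutionOn (slab (EuclideanSpace ℝ (Fin 3)) (Ioi 0) isOpen_Ioi) ν 0 v π) (hν : 0 ≤ ν)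
    {T : ℝ} {C D : ℝ≥0}
    (hC : ∀ᵐ τ ∂(volume.restrict (Ioo (0 : ℝ) T)), ∀ x₀ : (EuclideanSpace ℝ (Fin 3)), ∫⁻ x in ball x₀ 1, ‖v τ x‖ₑ ^ 2 ≤ C)
    {R : ℝ} {F : Finset (EuclideanSpace ℝ (Fin 3))} (hF : ball (0 : (EuclideanSpace ℝ (Fin 3))) R ⊆ ⋃ c ∈ F, ball c 1) {c : ℝ → ℝ} (hc : Measurable c)
    (hD : ∫⁻ z in Ioo 0 T ×ˢ ball (0 : (EuclideanSpace ℝ (Fin 3))) R, ‖π z.1 z.2 - c z.1‖ₑ ^ (3 / 2 : ℝ) ≤ D)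
    {η : (EuclideanSpace ℝ (Fin 3)) → (EuclideanSpace ℝ (Fin 3))} (hη : FunctionSpaces.IsTestFunctionOn (⊤ : Opens (EuclideanSpace ℝ (Fin 3))) η)
    (hηR : tsupport η ⊆ ball (0 : (EuclideanSpace ℝ (Fin 3))) R) {K₁ K₂ : ℝ}
    (hK₁ : ∀ x, ‖fderiv ℝ η x‖ ≤ K₁) (hK₂ : ∀ x, ‖Δ η x‖ ≤ K₂)
    {V : ℝ → ℝ} {s t : ℝ} (hs : 0 < s) (hst : s < t) (htT : t ≤ T)
    (hV : V t - V s = ∫ τ in Ioc s t, pairingFlux ν v π η τ) :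
    |V t - V s| ≤
      K₁ * (F.card * C) * (t - s) +
        ν * K₂ * Real.sqrt (F.card * C * (volume (ball (0 : (EuclideanSpace ℝ (Fin 3))) R)).toReal) * (t - s) +
        3 * K₁ * ((D : ℝ) ^ (2 / 3 : ℝ) * (volume (ball (0 : (EuclideanSpace ℝ (Fin 3))) R)).toReal ^ (1 / 3 : ℝ)) *
          (t - s) ^ (1 / 3 : ℝ) := by
  have hK₁0 : 0 ≤ K₁ := (norm_nonneg _).trans (hK₁ 0)
  have hK₂0 : 0 ≤ K₂ := (norm_nonneg _).trans (hK₂ 0)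
  have hts : 0 < t - s := sub_pos.2 hst
  set VRe : ℝ≥0∞ := volume (ball (0 : (EuclideanSpace ℝ (Fin 3))) R) with hVRe
  have hVRe_top : VRe ≠ ∞ := measure_ball_lt_top.ne
  set VR : ℝ := VRe.toReal with hVR
  have hVR0 : 0 ≤ VR := ENNReal.toReal_nonneg
  set N : ℝ≥0 := (F.card : ℝ≥0) with hN
  have hNcast : ((F.card : ℝ≥0∞)) = (N : ℝ≥0∞) := by rw [hN]; norm_cast
  -- the three bounds and the flux estimate
  have hflux := lintegral_enorm_pairingFlux_le_slab hsol hν hη hηR hK₁ hK₂ hc hs (t := t)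
  obtain ⟨hI1, hI2, hI3⟩ := strip_lintegral_bounds_slab hsol hC hF hc hD hs htT
  rw [hNcast] at hI1 hI2
  -- conversion of the total bound to a real number
  set X : ℝ≥0∞ := (N * C : ℝ≥0∞) * ENNReal.ofReal (t - s) with hX
  set Y : ℝ≥0∞ := ENNReal.ofReal (t - s) * VRe with hY
  have hNC : (N * C : ℝ≥0∞) = ENNReal.ofReal ((N : ℝ) * C) := by
    rw [ENNReal.ofReal_mul N.coe_nonneg, ENNReal.ofReal_coe_nnreal, ENNReal.ofReal_coe_nnreal]
  have hXr : X = ENNReal.ofReal ((N : ℝ) * C * (t - s)) := by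
    rw [hX, hNC, ← ENNReal.ofReal_mul (by positivity)]
  have hYr : Y = ENNReal.ofReal ((t - s) * VR) := by
    rw [hY, hVR, ENNReal.ofReal_mul hts.le, ENNReal.ofReal_toReal hVRe_top]
  set A₁ : ℝ := K₁ * (N * C) with hA₁
  set A₂ : ℝ := ν * K₂ * Real.sqrt (N * C * VR) with hA₂
  set B : ℝ := 3 * K₁ * ((D : ℝ) ^ (2 / 3 : ℝ) * VR ^ (1 / 3 : ℝ)) with hB
  have hT1 : ENNReal.ofReal K₁ * X = ENNReal.ofReal (A₁ * (t - s)) := by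
    rw [hXr, ← ENNReal.ofReal_mul hK₁0, hA₁]
    ring_nf
  have hT2 : ENNReal.ofReal (ν * K₂) * (X ^ (1 / 2 : ℝ) * Y ^ (1 / 2 : ℝ)) =
      ENNReal.ofReal (A₂ * (t - s)) := by
    rw [hXr, hYr, ENNReal.ofReal_rpow_of_nonneg (by positivity) (by norm_num),
      ENNReal.ofReal_rpow_of_nonneg (by positivity) (by norm_num),
      ← ENNReal.ofReal_mul (by positivity), ← ENNReal.ofReal_mul (by positivity), hA₂]
    congr 1
    have e : ((N : ℝ) * C * (t - s)) ^ (1 / 2 : ℝ) * ((t - s) * VR) ^ (1 / 2 : ℝ) =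
        (t - s) * Real.sqrt (N * C * VR) := by
      rw [← Real.sqrt_eq_rpow, ← Real.sqrt_eq_rpow, ← Real.sqrt_mul (by positivity),
        show (N : ℝ) * C * (t - s) * ((t - s) * VR) = (t - s) ^ 2 * (N * C * VR) by ring,
        Real.sqrt_mul (sq_nonneg _), Real.sqrt_sq hts.le]
    rw [mul_assoc, e]
    ring
  have hT3 : ENNReal.ofReal (3 * K₁) * ((D : ℝ≥0∞) ^ (2 / 3 : ℝ) * Y ^ (1 / 3 : ℝ)) =
      ENNReal.ofReal (B * (t - s) ^ (1 / 3 : ℝ)) := by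
    rw [hYr, ← ENNReal.ofReal_coe_nnreal, ENNReal.ofReal_rpow_of_nonneg D.coe_nonneg (by norm_num),
      ENNReal.ofReal_rpow_of_nonneg (by positivity) (by norm_num),
      ← ENNReal.ofReal_mul (by positivity), ← ENNReal.ofReal_mul (by positivity), hB,
      Real.mul_rpow hts.le hVR0]
    ring_nf
  have hA₁0 : 0 ≤ A₁ * (t - s) := by rw [hA₁]; positivity
  have hA₂0 : 0 ≤ A₂ * (t - s) := by rw [hA₂]; positivity
  have hB0 : 0 ≤ B * (t - s) ^ (1 / 3 : ℝ) := by rw [hB]; positivity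
  have htotal : ∫⁻ τ in Ioc s t, ‖pairingFlux ν v π η τ‖ₑ ≤
      ENNReal.ofReal (A₁ * (t - s) + A₂ * (t - s) + B * (t - s) ^ (1 / 3 : ℝ)) := by
    refine hflux.trans ?_
    rw [ENNReal.ofReal_add (by positivity) hB0, ENNReal.ofReal_add hA₁0 hA₂0, ← hT1, ← hT2, ← hT3]
    gcongr
  -- conclusion
  have e0 : K₁ * (F.card * C) * (t - s) + ν * K₂ * Real.sqrt (F.card * C * VR) * (t - s) +
      3 * K₁ * ((D : ℝ) ^ (2 / 3 : ℝ) * VR ^ (1 / 3 : ℝ)) * (t - s) ^ (1 / 3 : ℝ) =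
      A₁ * (t - s) + A₂ * (t - s) + B * (t - s) ^ (1 / 3 : ℝ) := by
    rw [hA₁, hA₂, hB, hN, NNReal.coe_natCast]
  rw [hV, e0]
  calc |∫ τ in Ioc s t, pairingFlux ν v π η τ| = ‖∫ τ in Ioc s t, pairingFlux ν v π η τ‖ :=
        (Real.norm_eq_abs _).symm
    _ ≤ (∫⁻ τ in Ioc s t, ‖pairingFlux ν v π η τ‖ₑ).toReal := by
        have := norm_integral_le_lintegral_norm (μ := volume.restrict (Ioc s t)) (pairingFlux ν v π η)
        simpa only [ofReal_norm] using this
    _ ≤ (ENNReal.ofReal (A₁ * (t - s) + A₂ * (t - s) + B * (t - s) ^ (1 / 3 : ℝ))).toReal :=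
        ENNReal.toReal_mono ENNReal.ofReal_ne_top htotal
    _ = A₁ * (t - s) + A₂ * (t - s) + B * (t - s) ^ (1 / 3 : ℝ) := ENNReal.toReal_ofReal (by positivity)

/-- **Equicontinuity of the (versions of the) pairings, uniformly over distributional solutions
on the slab with uniform a.e. local energy and pressure control** (the estimate behind
(B.4.4)/(B.4.10) of Seregin 2014, App. B; Lemarié-Rieusset 2016, p. 571: "`v_{n_k}` and
`∂ₜv_{n_k}` are bounded in `(L²H^{-3/2})_uloc`"). For `ν ≥ 0`, `T`, constants `C, D`, a radius `R`
and a test field `η` supported in `B(0, R)` there is `K` such that for every distributional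
solution `(v, π)` on `(0,∞) × ℝ³` with `∫_{B(x₀,1)} |v(τ)|² ≤ C` for a.e. `τ ∈ (0,T)` and all `x₀`,
and `∫₀ᵀ∫_{B(0,R)} |π|^{3/2} ≤ D`, every function `V` with `V t − V s = ∫_{]s,t]} f_η` on an interval
`]a, b[ ⊆ ]0, T]` satisfies `|V t − V s| ≤ K (t − s)^{1/3}` for `a < s ≤ t < b`.
[cite: Seregin2014, App. B §B.4 (B.4.4) and (B.4.10)] -/
theorem exists_modulus_slab (hν : 0 ≤ ν) {T : ℝ} (hT : 0 < T) (C D : ℝ≥0) (R : ℝ)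
    {η : (EuclideanSpace ℝ (Fin 3)) → (EuclideanSpace ℝ (Fin 3))} (hη : FunctionSpaces.IsTestFunctionOn (⊤ : Opens (EuclideanSpace ℝ (Fin 3))) η)
    (hηR : tsupport η ⊆ ball (0 : (EuclideanSpace ℝ (Fin 3))) R) :
    ∃ K : ℝ, 0 ≤ K ∧ ∀ (v : ℝ → (EuclideanSpace ℝ (Fin 3)) → (EuclideanSpace ℝ (Fin 3))) (π : ℝ → (EuclideanSpace ℝ (Fin 3)) → ℝ),
      IsDistributionalNSSolutionOn (slab (EuclideanSpace ℝ (Fin 3)) (Ioi 0) isOpen_Ioi) ν 0 v π →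
      (∀ᵐ τ ∂(volume.restrict (Ioo (0 : ℝ) T)), ∀ x₀ : (EuclideanSpace ℝ (Fin 3)), ∫⁻ x in ball x₀ 1, ‖v τ x‖ₑ ^ 2 ≤ C) →
      (∫⁻ z in Ioo 0 T ×ˢ ball (0 : (EuclideanSpace ℝ (Fin 3))) R, ‖π z.1 z.2‖ₑ ^ (3 / 2 : ℝ) ≤ D) →
      ∀ {a b : ℝ}, 0 < a → b ≤ T → ∀ V : ℝ → ℝ,
        (∀ s ∈ Ioo a b, ∀ t ∈ Ioo a b, s ≤ t → V t - V s = ∫ τ in Ioc s t, pairingFlux ν v π η τ) →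
        ∀ s ∈ Ioo a b, ∀ t ∈ Ioo a b, s ≤ t → |V t - V s| ≤ K * (t - s) ^ (1 / 3 : ℝ) := by
  obtain ⟨K₀, K₁, K₂, -, hK₁, hK₂⟩ := exists_bounds_of_isTestFunctionOn hη
  have hK₁0 : 0 ≤ K₁ := (norm_nonneg _).trans (hK₁ 0)
  have hK₂0 : 0 ≤ K₂ := (norm_nonneg _).trans (hK₂ 0)
  obtain ⟨F, hF⟩ := exists_finset_ball_subset_biUnion_ball_one R
  have hF0 : ball (0 : (EuclideanSpace ℝ (Fin 3))) R ⊆ ⋃ c ∈ F, ball c 1 := by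
    have := hF 0
    simpa only [zero_add] using this
  set VR : ℝ := (volume (ball (0 : (EuclideanSpace ℝ (Fin 3))) R)).toReal with hVR
  have hVR0 : 0 ≤ VR := ENNReal.toReal_nonneg
  set A : ℝ := K₁ * (F.card * C) + ν * K₂ * Real.sqrt (F.card * C * VR) with hA
  set B : ℝ := 3 * K₁ * ((D : ℝ) ^ (2 / 3 : ℝ) * VR ^ (1 / 3 : ℝ)) with hB
  have hA0 : 0 ≤ A := by rw [hA]; positivity
  have hB0 : 0 ≤ B := by rw [hB]; positivity
  set K : ℝ := A * T ^ (2 / 3 : ℝ) + B with hK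
  have hK0 : 0 ≤ K := by rw [hK]; positivity
  refine ⟨K, hK0, fun v π hsol hC hD a b ha hbT V hV s hs t ht hst => ?_⟩
  have hD' : ∫⁻ z in Ioo 0 T ×ˢ ball (0 : (EuclideanSpace ℝ (Fin 3))) R, ‖π z.1 z.2 - (fun _ : ℝ => (0 : ℝ)) z.1‖ₑ ^ (3 / 2 : ℝ) ≤ D := by
    simpa only [sub_zero] using hD
  rcases eq_or_lt_of_le hst with rfl | hst'
  · simp only [sub_self, abs_zero, Real.zero_rpow (by norm_num : (1 / 3 : ℝ) ≠ 0), mul_zero, le_refl]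
  have hcore := abs_sub_le_core_slab hsol hν hC hF0 measurable_const hD' hη hηR hK₁ hK₂
    (ha.trans hs.1) hst' (ht.2.le.trans hbT) (hV s hs t ht hst)
  refine hcore.trans ?_
  have e : K₁ * (F.card * C) * (t - s) + ν * K₂ * Real.sqrt (F.card * C * VR) * (t - s) +
      3 * K₁ * ((D : ℝ) ^ (2 / 3 : ℝ) * VR ^ (1 / 3 : ℝ)) * (t - s) ^ (1 / 3 : ℝ) =
      A * (t - s) + B * (t - s) ^ (1 / 3 : ℝ) := by rw [hA, hB]; ring
  rw [e, hK]
  exact linear_add_rpow_third_le hA0 (sub_pos.2 hst').le (by linarith [hs.1.le, ht.2.le, ha.le])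

end Trace

end LocalLerayLimit

end Literature.Analysis.FluidPDE

end
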